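import Literature.NumberTheory.Sieve.FriedlanderIwaniecPrimes
import Literature.NumberTheory.Sieve.DivisorBound
import HarnessLib

/-!
# Friedlander–Iwaniec, *The polynomial `X² + Y⁴` captures its primes*: infinitely many primes `a² + b⁴`

Family `parity`, statement parity.S17, qualitative clause
`Literature.NumberTheory.Sieve.setOf_prime_sq_add_pow_four_infinite` ("there are infinitely many primes of the form
`a² + b⁴`", `Literature.NumberTheory.Sieve.ParityWave0`). Source: J. Friedlander, H. Iwaniec,
Ann. of Math. (2) 148 (1998), 945–1040 [FriedlanderIwaniecAnnals1998] (= arXiv:math/9811185):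
§1 Theorem 1 (1.1)–(1.2); §2 (2.2); §3 (closing paragraph); §4 (4.1), (4.2), (4.7)–(4.8).

`Literature.NumberTheory.Sieve.FriedlanderIwaniecPrimes` formalises the printed architecture of
Theorem 1 down to seven named facts and proves its QUANTITATIVE clause
`friedlanderIwaniecSum_isEquivalent` (`∑∑_{a² + b⁴ ≤ x} Λ(a² + b⁴) ∼ 4π⁻¹κ x^{3/4}`) from them.
This file adds what that route leaves out for the QUALITATIVE clause, and removes one of the
seven facts:

* `setOf_prime_sq_add_pow_four_infinite_of_isEquivalent` (section `FriedlanderIwaniec`): the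
  paper passes from (1.1) to "infinitely many primes `a² + b⁴`" without comment (§1: "we prove
  that there are infinitely many primes of the form `a² + b⁴`, in fact getting the asymptotic
  formula"); the step needs the prime powers `p^k = a² + b⁴`, `k ≥ 2`, `a, b ≥ 1`, to contribute
  `o(x^{3/4})` to (1.1): `k = 2` via primitive Pythagorean triples
  (`exists_param_of_sq_add_pow_four_eq_prime_sq`, Mathlib's
  `PythagoreanTriple.coprime_classification`), `k ≥ 3` by direct counting, altogether `O(x^{2/3})`
  (`log_mul_card_le_rpow`); if only finitely many primes were `a² + b⁴` the sum (1.1) would be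
  `O(x^{2/3})`, contradicting `∼ 4π⁻¹κ x^{3/4}`, `κ > 0`;
* `fiRepCount_eq_four_mul_card` (section `OneFourth`): the "one fourth" of §4 — for a prime `p`,
  `a_p = 4 · #{a, b ≥ 1 : a² + b⁴ = p}` (no solution of `a² + c⁴ = p` has a zero coordinate);
* `friedlanderIwaniecSum_isBigO_of_count_of_primeSum` (section `Assembly`): Theorem 1 AS PRINTED,
  with its error term, `∑∑ Λ(a² + b⁴) − 4π⁻¹κ x^{3/4} = O(x^{3/4} log log x / log x)` along
  `x : ℕ`, from (4.2) (`FriedlanderIwaniec1998_count_asymp`) and (4.7)–(4.8)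
  (`FriedlanderIwaniec1998_primeSum_asymp`) — the `IsBigO` refinement of
  `friedlanderIwaniecSum_isEquivalent_of_count_of_primeSum`, via the exact splitting
  "prime part `= ¼ S(x)`" (`sum_prime_part_eq_fiPrimeSum_div_four`) + "prime-power part
  `≤ 2784 x^{2/3}`"; and `friedlanderIwaniecSum_isEquivalent_of_isBigO` (printed form ⟹ `∼` form);
* `FriedlanderIwaniec1998_hyp22_holds` (section `Hyp22`): the DISCHARGE of the named fact (2.2),
  `A(x) ≫ x^{1/3} (∑_{n ≤ x} a_n²)^{1/2}` ("obvious in our case", §3): `∑_{n ≤ x} a_n²` counts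
  quadruples `a² + c⁴ = a'² + c'⁴ ≤ x`; those with `c' = ±c` are `≤ 4 A(x)`, the others factor
  `(a − a')(a + a') = c'⁴ − c⁴ ≠ 0` and are `≤ 2τ(|c'⁴ − c⁴|) ≪ x^{1/4}` per pair `(c, c')`
  (`card_filter_sq_sub_sq_eq_le`, the divisor bound `Literature.NumberTheory.Sieve.exists_card_divisors_le_mul_rpow`), so
  `∑ a_n² ≪ x^{3/4}` (`sum_sq_fiRepCount_le`) and `x^{1/3}(∑ a_n²)^{1/2} ≪ x^{17/24} = o(A(x))`;
* corollaries (section `Corollaries`): `setOf_prime_sq_add_pow_four_infinite_of_primeSum`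
  ((4.7)–(4.8) alone suffice), `FriedlanderIwaniec1998_primeSum_asymp_of_inputs'`,
  `friedlanderIwaniecSum_isEquivalent_of_inputs'`, and
  **`setOf_prime_sq_add_pow_four_infinite_of_inputs`**: parity.S17's qualitative clause from
  the SIX named facts `FriedlanderIwaniec1998_prop21`, `_prop35`, `_prop41`, `_densityConstant`,
  `_hyp27`, `_hyp28`; its discharge `setOf_prime_sq_add_pow_four_infinite_holds` awaits theirs.

## References

* J. Friedlander, H. Iwaniec, *The polynomial `X² + Y⁴` captures its primes*, Ann. of Math. (2)
  148 (1998), 945–1040, doi:10.2307/121034 = arXiv:math/9811185: §1 Theorem 1 (1.1)–(1.2); §2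
  (2.2); §3, closing paragraph; §4 (4.1), (4.2), (4.7)–(4.8) and the paragraph after (4.8).
  [cite: FriedlanderIwaniecAnnals1998]
* G. H. Hardy, E. M. Wright, *An Introduction to the Theory of Numbers*, 6th ed., OUP 2008,
  Theorem 315 (the divisor bound, as vendored in `Literature.NumberTheory.Sieve.DivisorBound`).
  [cite: HardyWright2008, Theorem 315]
-/

noncomputable section

open Filter Asymptotics Finset
open scoped ArithmeticFunction.vonMangoldt Topology

namespace Literature.NumberTheory.Sieve

/-! ### Primes of the form `a² + b⁴` (parity.S17): the qualitative statement from the asymptotic formula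

`Literature.NumberTheory.Sieve.setOf_prime_sq_add_pow_four_infinite` ("there are infinitely many primes of the form
`a² + b⁴`") is the qualitative content of Friedlander–Iwaniec, Ann. of Math. 148 (1998), §1,
Theorem 1, (1.1): `∑∑_{a² + b⁴ ≤ x} Λ(a² + b⁴) = 4π⁻¹κ x^{3/4} (1 + O(log log x / log x))`, `a, b`
running over positive integers, `κ = ∫₀¹ (1 − t⁴)^{1/2} dt` (1.2); the asymptotic is vendored (in
`IsEquivalent` form) as the named fact `Literature.NumberTheory.Sieve.friedlanderIwaniecSum_isEquivalent`. The paper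
("we prove that there are infinitely many primes of the form `a² + b⁴`, in fact getting the
asymptotic formula", §1) passes from (1.1) to the qualitative statement without comment; the step
needs the prime powers `p^k = a² + b⁴`, `k ≥ 2`, to contribute `o(x^{3/4})` to (1.1), proved here:
* `k = 2`: `a² + (b²)² = p²` with `a, b ≥ 1` is a *primitive* Pythagorean triple (`gcd(a, b²) ∣ p`
  and `0 < a < p`), so Mathlib's `PythagoreanTriple.coprime_classification` gives `p = m² + n²` and
  `(a, b²) ∈ {(m² − n², 2mn), (2mn, m² − n²)}` with `m⁴, n⁴ ≤ p² ≤ x`: at most `2(2x^{1/4} + 1)²`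
  pairs (`exists_param_of_sq_add_pow_four_eq_prime_sq`,
  `card_filter_sq_add_pow_four_eq_prime_sq_le`);
* `k ≥ 3`: `(a, b) ↦ (p, k, b)` is injective with `p³ ≤ x`, `2^k ≤ x`, `b⁴ ≤ x`: at most
  `#{p ≤ x : p³ ≤ x} · (log₂ x + 1) · x^{1/4}` pairs
  (`card_filter_sq_add_pow_four_eq_higher_prime_pow_le`);
each weighted by `Λ(n) ≤ log x`, the prime-power part of (1.1) is `≤ 2784 x^{2/3}` for `x ≥ 1`
(`friedlanderIwaniecSum_le_sum_prime_add`, `log_mul_card_le_rpow`, via `log x ≤ 24 x^{1/24}`).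
If only finitely many primes had the form `a² + b⁴` (all `≤ N₀`), the prime part of (1.1) would
be `≤ N₀² log N₀` for every `x`, so the sum would be `O(x^{2/3})`, contradicting
`∼ 4π⁻¹κ x^{3/4}` with `κ > 0` (`friedlanderIwaniecKappa_pos`):
`setOf_prime_sq_add_pow_four_infinite_of_isEquivalent`. This is the top node of the discharge
DAG of the qualitative clause of parity.S17; below it, `FriedlanderIwaniecPrimes` proves
`friedlanderIwaniecSum_isEquivalent` from the paper's route (Proposition 2.1 = the asymptotic
sieve for primes of the companion paper, Proposition 3.5 = the level of distribution (2.9),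
Proposition 4.1 = the bilinear form bound (2.11), the Euler product (4.8), and the hypotheses
(2.2), (2.7), (2.8)), see `friedlanderIwaniecSum_isEquivalent_of_inputs` there and
`setOf_prime_sq_add_pow_four_infinite_of_inputs` below. -/

section FriedlanderIwaniec

open Filter Asymptotics
open scoped ArithmeticFunction.vonMangoldt

/-- Pointwise splitting of the von Mangoldt function according to the exponent of the prime power:
`Λ(n) ≤ [n prime] Λ(n) + [n = p², p prime] log n + [n = p^k, k ≥ 3] log n`, the last two classes
written decidably as "`√n` is prime and `(√n)² = n`" and "`n` is a prime power, not a prime, not the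
square of a prime" (`Λ(n) = 0` off prime powers, `0 ≤ Λ(n) ≤ log n`). [folklore] -/
theorem vonMangoldt_le_prime_add_sq_add_higher (n : ℕ) :
    Λ n ≤ (if n.Prime then Λ n else 0) +
      (if (n.sqrt.Prime ∧ n.sqrt ^ 2 = n) then Real.log n else 0) +
      (if (IsPrimePow n ∧ ¬ n.Prime ∧ ¬ (n.sqrt.Prime ∧ n.sqrt ^ 2 = n)) then Real.log n else 0) := by
  have hlog : 0 ≤ Real.log n := Real.log_natCast_nonneg n
  have hnn : 0 ≤ Λ n := ArithmeticFunction.vonMangoldt_nonneg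
  have hle : Λ n ≤ Real.log n := ArithmeticFunction.vonMangoldt_le_log
  by_cases hpp : IsPrimePow n
  · by_cases hp : n.Prime
    · rw [if_pos hp]; split_ifs <;> linarith
    · by_cases hsq : n.sqrt.Prime ∧ n.sqrt ^ 2 = n
      · rw [if_neg hp, if_pos hsq]; split_ifs <;> linarith
      · rw [if_neg hp, if_neg hsq, if_pos ⟨hpp, hp, hsq⟩]; linarith
  · rw [ArithmeticFunction.vonMangoldt_eq_zero_iff.mpr hpp]
    split_ifs <;> linarith

/-- Parametrisation of the solutions of `a² + b⁴ = p²` (`a, b ≥ 1`, `p` prime): `(a, b², p)` is a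
Pythagorean triple, primitive because `gcd(a, b²)` divides `p` (Mathlib
`PythagoreanTriple.gcd_dvd`) and also divides `a` with `0 < a < p`; Mathlib's classification of
primitive triples (`PythagoreanTriple.coprime_classification`) then gives integers `m, n` with
`p = m² + n²` and `(a, b²) = (m² − n², 2mn)` or `(2mn, m² − n²)`. [folklore] -/
theorem exists_param_of_sq_add_pow_four_eq_prime_sq {a b p : ℕ} (ha : 0 < a) (hb : 0 < b)
    (hp : p.Prime) (h : a ^ 2 + b ^ 4 = p ^ 2) :
    ∃ m n : ℤ, (p : ℤ) = m ^ 2 + n ^ 2 ∧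
      (((a : ℤ) = m ^ 2 - n ^ 2 ∧ ((b : ℤ)) ^ 2 = 2 * m * n) ∨
        ((a : ℤ) = 2 * m * n ∧ ((b : ℤ)) ^ 2 = m ^ 2 - n ^ 2)) := by
  have ht : PythagoreanTriple (a : ℤ) ((b : ℤ) ^ 2) p := by
    unfold PythagoreanTriple
    have := congrArg (Nat.cast : ℕ → ℤ) h
    push_cast at this
    linear_combination this
  have hgcd : Int.gcd (a : ℤ) ((b : ℤ) ^ 2) = 1 := by
    have hdvd : (Int.gcd (a : ℤ) ((b : ℤ) ^ 2) : ℤ) ∣ (p : ℤ) := ht.gcd_dvd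
    have hdvd' : Int.gcd (a : ℤ) ((b : ℤ) ^ 2) ∣ p := by exact_mod_cast hdvd
    rcases (Nat.dvd_prime hp).mp hdvd' with h1 | h2
    · exact h1
    · exfalso
      have hga : (Int.gcd (a : ℤ) ((b : ℤ) ^ 2) : ℤ) ∣ (a : ℤ) := Int.gcd_dvd_left ..
      rw [h2] at hga
      have hpa : p ∣ a := by exact_mod_cast hga
      have hap : a < p := by
        have hb4 : 0 < b ^ 4 := by positivity
        have : a ^ 2 < p ^ 2 := by linarith
        exact (Nat.pow_lt_pow_iff_left (by norm_num)).mp this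
      exact absurd (Nat.le_of_dvd ha hpa) (not_le.mpr hap)
  obtain ⟨m, n, hxy, hz, -, -⟩ := PythagoreanTriple.coprime_classification.mp ⟨ht, hgcd⟩
  refine ⟨m, n, ?_, hxy⟩
  rcases hz with hz | hz
  · exact hz
  · exfalso
    have : (0 : ℤ) < p := by exact_mod_cast hp.pos
    nlinarith [sq_nonneg m, sq_nonneg n]

/-- Counting the pairs `1 ≤ a, b ≤ x` with `a² + b⁴ ≤ x` equal to the square of a prime: by
`exists_param_of_sq_add_pow_four_eq_prime_sq` such a pair is the image of some
`(m, n, branch) ∈ [−R, R]² × Bool`, `R = ⌊⌊√x⌋^{1/2}⌋` (as `m⁴, n⁴ ≤ p² ≤ x`), under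
`(m, n) ↦ (|m² − n²|, √|2mn|)` resp. `(|2mn|, √|m² − n²|)`; hence there are at most `2(2R + 1)²`
of them (the crude form of "`O(√x)` solutions of `p² = a² + b⁴` with `p² ≤ x`"). [folklore] -/
theorem card_filter_sq_add_pow_four_eq_prime_sq_le (x : ℕ) :
    #{ab ∈ Icc 1 x ×ˢ Icc 1 x | ab.1 ^ 2 + ab.2 ^ 4 ≤ x ∧
        ((ab.1 ^ 2 + ab.2 ^ 4).sqrt.Prime ∧ (ab.1 ^ 2 + ab.2 ^ 4).sqrt ^ 2 = ab.1 ^ 2 + ab.2 ^ 4)} ≤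
      2 * (2 * x.sqrt.sqrt + 1) ^ 2 := by
  set R : ℕ := x.sqrt.sqrt with hR
  let F : ℤ × ℤ × Bool → ℕ × ℕ := fun t =>
    if t.2.2 then ((t.1 ^ 2 - t.2.1 ^ 2).natAbs, ((2 * t.1 * t.2.1).natAbs).sqrt)
    else ((2 * t.1 * t.2.1).natAbs, ((t.1 ^ 2 - t.2.1 ^ 2).natAbs).sqrt)
  have hbox : ∀ m : ℤ, ∀ p : ℕ, p ^ 2 ≤ x → m ^ 2 ≤ (p : ℤ) → m ∈ Icc (-(R : ℤ)) R := by
    intro m p hpx hmp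
    have h1 : m.natAbs ^ 2 ≤ p := by
      have : ((m.natAbs : ℤ)) ^ 2 ≤ (p : ℤ) := by rwa [Int.natAbs_sq]
      exact_mod_cast this
    have h2 : m.natAbs ^ 4 ≤ x := by
      calc m.natAbs ^ 4 = (m.natAbs ^ 2) ^ 2 := by ring
        _ ≤ p ^ 2 := Nat.pow_le_pow_left h1 2
        _ ≤ x := hpx
    have h3 : m.natAbs ≤ R := by
      rw [hR, Nat.le_sqrt', Nat.le_sqrt']
      calc (m.natAbs ^ 2) ^ 2 = m.natAbs ^ 4 := by ring
        _ ≤ x := h2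
    have h4 : |m| ≤ (R : ℤ) := by
      rw [← Int.natCast_natAbs]; exact_mod_cast h3
    rw [mem_Icc]; exact abs_le.mp h4
  have hsub : {ab ∈ Icc 1 x ×ˢ Icc 1 x | ab.1 ^ 2 + ab.2 ^ 4 ≤ x ∧
        ((ab.1 ^ 2 + ab.2 ^ 4).sqrt.Prime ∧ (ab.1 ^ 2 + ab.2 ^ 4).sqrt ^ 2 = ab.1 ^ 2 + ab.2 ^ 4)} ⊆
      ((Icc (-(R : ℤ)) R) ×ˢ ((Icc (-(R : ℤ)) R) ×ˢ (univ : Finset Bool))).image F := by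
    intro ab hab
    simp only [mem_filter, mem_product, mem_Icc] at hab
    obtain ⟨⟨⟨ha1, -⟩, ⟨hb1, -⟩⟩, hle, hprime, hsq⟩ := hab
    set p := (ab.1 ^ 2 + ab.2 ^ 4).sqrt with hp
    obtain ⟨m, n, hpmn, hmn⟩ :=
      exists_param_of_sq_add_pow_four_eq_prime_sq ha1 hb1 hprime hsq.symm
    have hpx : p ^ 2 ≤ x := hsq ▸ hle
    have hm : m ∈ Icc (-(R : ℤ)) R := hbox m p hpx (by nlinarith [sq_nonneg n])
    have hn : n ∈ Icc (-(R : ℤ)) R := hbox n p hpx (by nlinarith [sq_nonneg m])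
    rw [mem_image]
    rcases hmn with ⟨h1, h2⟩ | ⟨h1, h2⟩
    · refine ⟨(m, n, true), by simp only [mem_product]; exact ⟨hm, hn, mem_univ _⟩, ?_⟩
      change ((m ^ 2 - n ^ 2).natAbs, ((2 * m * n).natAbs).sqrt) = ab
      rw [← h1, ← h2, Int.natAbs_natCast, ← Nat.cast_pow, Int.natAbs_natCast, Nat.sqrt_eq']
    · refine ⟨(m, n, false), by simp only [mem_product]; exact ⟨hm, hn, mem_univ _⟩, ?_⟩
      change ((2 * m * n).natAbs, ((m ^ 2 - n ^ 2).natAbs).sqrt) = ab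
      rw [← h1, ← h2, Int.natAbs_natCast, ← Nat.cast_pow, Int.natAbs_natCast, Nat.sqrt_eq']
  have hIcc : #(Icc (-(R : ℤ)) R) = 2 * R + 1 := by
    rw [Int.card_Icc]
    have : (R : ℤ) + 1 - -(R : ℤ) = ((2 * R + 1 : ℕ) : ℤ) := by push_cast; ring
    rw [this, Int.toNat_natCast]
  calc _ ≤ #(((Icc (-(R : ℤ)) R) ×ˢ ((Icc (-(R : ℤ)) R) ×ˢ (univ : Finset Bool))).image F) :=
        card_le_card hsub
    _ ≤ #((Icc (-(R : ℤ)) R) ×ˢ ((Icc (-(R : ℤ)) R) ×ˢ (univ : Finset Bool))) := card_image_le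
    _ = 2 * (2 * R + 1) ^ 2 := by
        rw [card_product, card_product, hIcc, card_univ, Fintype.card_bool]; ring

/-- Counting the pairs `1 ≤ a, b ≤ x` with `a² + b⁴ ≤ x` a prime power `p^k` with `k ≥ 3` (a prime
power that is neither a prime nor the square of a prime): `(a, b)` is the image of `(p, k, b)` under
`(p, k, b) ↦ (√(p^k − b⁴), b)`, where `p³ ≤ p^k ≤ x`, `2^k ≤ x` (so `k ≤ log₂ x`) and `b⁴ ≤ x`; hence
at most `#{p ≤ x : p³ ≤ x} · (log₂ x + 1) · ⌊⌊√x⌋^{1/2}⌋` of them. [folklore] -/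
theorem card_filter_sq_add_pow_four_eq_higher_prime_pow_le (x : ℕ) :
    #{ab ∈ Icc 1 x ×ˢ Icc 1 x | ab.1 ^ 2 + ab.2 ^ 4 ≤ x ∧
        (IsPrimePow (ab.1 ^ 2 + ab.2 ^ 4) ∧ ¬ (ab.1 ^ 2 + ab.2 ^ 4).Prime ∧
          ¬ ((ab.1 ^ 2 + ab.2 ^ 4).sqrt.Prime ∧
            (ab.1 ^ 2 + ab.2 ^ 4).sqrt ^ 2 = ab.1 ^ 2 + ab.2 ^ 4))} ≤
      #{p ∈ range (x + 1) | p ^ 3 ≤ x} * (Nat.log 2 x + 1) * x.sqrt.sqrt := by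
  let G : ℕ × ℕ × ℕ → ℕ × ℕ := fun t => ((t.1 ^ t.2.1 - t.2.2 ^ 4).sqrt, t.2.2)
  have hsub : {ab ∈ Icc 1 x ×ˢ Icc 1 x | ab.1 ^ 2 + ab.2 ^ 4 ≤ x ∧
        (IsPrimePow (ab.1 ^ 2 + ab.2 ^ 4) ∧ ¬ (ab.1 ^ 2 + ab.2 ^ 4).Prime ∧
          ¬ ((ab.1 ^ 2 + ab.2 ^ 4).sqrt.Prime ∧
            (ab.1 ^ 2 + ab.2 ^ 4).sqrt ^ 2 = ab.1 ^ 2 + ab.2 ^ 4))} ⊆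
      ({p ∈ range (x + 1) | p ^ 3 ≤ x} ×ˢ (range (Nat.log 2 x + 1) ×ˢ Icc 1 x.sqrt.sqrt)).image G := by
    intro ab hab
    simp only [mem_filter, mem_product, mem_Icc] at hab
    obtain ⟨⟨⟨ha1, -⟩, ⟨hb1, -⟩⟩, hle, hpp, hnp, hnsq⟩ := hab
    obtain ⟨p, k, hp, hk, hpk⟩ := (isPrimePow_nat_iff _).mp hpp
    have hk3 : 3 ≤ k := by
      by_contra hlt
      interval_cases k
      · exact hnp (by rw [← hpk, pow_one]; exact hp)
      · apply hnsq; rw [← hpk, Nat.sqrt_eq']; exact ⟨hp, rfl⟩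
    have hpkx : p ^ k ≤ x := hpk ▸ hle
    rw [mem_image]
    refine ⟨(p, k, ab.2), ?_, ?_⟩
    · simp only [mem_product, mem_filter, mem_range, mem_Icc]
      refine ⟨⟨?_, ?_⟩, ?_, hb1, ?_⟩
      · have : p ≤ p ^ k := Nat.le_self_pow (by omega) p
        omega
      · exact le_trans (Nat.pow_le_pow_right hp.pos hk3) hpkx
      · have h2k : 2 ^ k ≤ x := le_trans (Nat.pow_le_pow_left hp.two_le k) hpkx
        have := Nat.le_log_of_pow_le (by norm_num : 1 < 2) h2k
        omega
      · have h4 : ab.2 ^ 4 ≤ x := le_trans (Nat.le_add_left _ _) hle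
        rw [Nat.le_sqrt', Nat.le_sqrt']
        calc (ab.2 ^ 2) ^ 2 = ab.2 ^ 4 := by ring
          _ ≤ x := h4
    · simp only [G]
      rw [hpk, Nat.add_sub_cancel, Nat.sqrt_eq']
  calc _ ≤ #(({p ∈ range (x + 1) | p ^ 3 ≤ x} ×ˢ
          (range (Nat.log 2 x + 1) ×ˢ Icc 1 x.sqrt.sqrt)).image G) := card_le_card hsub
    _ ≤ #({p ∈ range (x + 1) | p ^ 3 ≤ x} ×ˢ (range (Nat.log 2 x + 1) ×ˢ Icc 1 x.sqrt.sqrt)) :=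
        card_image_le
    _ = _ := by rw [card_product, card_product, card_range, Nat.card_Icc, Nat.add_sub_cancel]; ring

/-- The Friedlander–Iwaniec sum split by the type of `n = a² + b⁴`:
`∑∑_{a² + b⁴ ≤ x} Λ(a² + b⁴) ≤ ∑∑_{a² + b⁴ ≤ x prime} Λ(a² + b⁴) + log x · (N₂ + N₃)`, where
`N₂ ≤ 2(2R + 1)²` and `N₃ ≤ #{p ≤ x : p³ ≤ x}(log₂ x + 1)R` (`R = ⌊⌊√x⌋^{1/2}⌋`) bound the numbers of
pairs for which `a² + b⁴` is the square resp. a higher power of a prime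
(`vonMangoldt_le_prime_add_sq_add_higher` termwise, `Λ(n) ≤ log n ≤ log x`, and the two counting
lemmas). [folklore] -/
theorem friedlanderIwaniecSum_le_sum_prime_add (x : ℕ) :
    friedlanderIwaniecSum x ≤
      (∑ ab ∈ Icc 1 x ×ˢ Icc 1 x with (ab.1 ^ 2 + ab.2 ^ 4 ≤ x ∧ (ab.1 ^ 2 + ab.2 ^ 4).Prime),
          Λ (ab.1 ^ 2 + ab.2 ^ 4)) +
        Real.log x * ((2 * (2 * x.sqrt.sqrt + 1) ^ 2 : ℕ) +
          (#{p ∈ range (x + 1) | p ^ 3 ≤ x} * (Nat.log 2 x + 1) * x.sqrt.sqrt : ℕ)) := by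
  have hlogx : 0 ≤ Real.log x := Real.log_natCast_nonneg x
  have hsum : friedlanderIwaniecSum x =
      ∑ ab ∈ Icc 1 x ×ˢ Icc 1 x,
        (if ab.1 ^ 2 + ab.2 ^ 4 ≤ x then Λ (ab.1 ^ 2 + ab.2 ^ 4) else 0) := by
    rw [friedlanderIwaniecSum, Finset.sum_product]
  have hpt : ∀ ab ∈ Icc 1 x ×ˢ Icc 1 x,
      (if ab.1 ^ 2 + ab.2 ^ 4 ≤ x then Λ (ab.1 ^ 2 + ab.2 ^ 4) else 0) ≤
        (if (ab.1 ^ 2 + ab.2 ^ 4 ≤ x ∧ (ab.1 ^ 2 + ab.2 ^ 4).Prime) then Λ (ab.1 ^ 2 + ab.2 ^ 4)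
          else 0) +
        Real.log x * (if (ab.1 ^ 2 + ab.2 ^ 4 ≤ x ∧
            ((ab.1 ^ 2 + ab.2 ^ 4).sqrt.Prime ∧ (ab.1 ^ 2 + ab.2 ^ 4).sqrt ^ 2 = ab.1 ^ 2 + ab.2 ^ 4))
            then 1 else 0) +
        Real.log x * (if (ab.1 ^ 2 + ab.2 ^ 4 ≤ x ∧
            (IsPrimePow (ab.1 ^ 2 + ab.2 ^ 4) ∧ ¬ (ab.1 ^ 2 + ab.2 ^ 4).Prime ∧
              ¬ ((ab.1 ^ 2 + ab.2 ^ 4).sqrt.Prime ∧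
                (ab.1 ^ 2 + ab.2 ^ 4).sqrt ^ 2 = ab.1 ^ 2 + ab.2 ^ 4))) then 1 else 0) := by
    intro ab hab
    simp only [mem_product, mem_Icc] at hab
    by_cases hle : ab.1 ^ 2 + ab.2 ^ 4 ≤ x
    · have hn0 : (0 : ℝ) < (ab.1 ^ 2 + ab.2 ^ 4 : ℕ) := by
        exact_mod_cast Nat.add_pos_left (pow_pos hab.1.1 2) _
      have hlogn : Real.log (ab.1 ^ 2 + ab.2 ^ 4 : ℕ) ≤ Real.log x :=
        Real.log_le_log hn0 (by exact_mod_cast hle)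
      have hΛ := vonMangoldt_le_prime_add_sq_add_higher (ab.1 ^ 2 + ab.2 ^ 4)
      have hΛ0 : 0 ≤ Λ (ab.1 ^ 2 + ab.2 ^ 4) := ArithmeticFunction.vonMangoldt_nonneg
      simp only [hle, true_and, if_true]
      split_ifs at hΛ ⊢ <;> linarith
    · simp [hle]
  rw [hsum]
  refine (Finset.sum_le_sum hpt).trans ?_
  rw [Finset.sum_add_distrib, Finset.sum_add_distrib, ← Finset.mul_sum, ← Finset.mul_sum,
    Finset.sum_boole, Finset.sum_boole, ← Finset.sum_filter]
  have h2 : ((#{ab ∈ Icc 1 x ×ˢ Icc 1 x | ab.1 ^ 2 + ab.2 ^ 4 ≤ x ∧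
        ((ab.1 ^ 2 + ab.2 ^ 4).sqrt.Prime ∧
          (ab.1 ^ 2 + ab.2 ^ 4).sqrt ^ 2 = ab.1 ^ 2 + ab.2 ^ 4)} : ℕ) : ℝ) ≤
      (2 * (2 * x.sqrt.sqrt + 1) ^ 2 : ℕ) := by
    exact_mod_cast card_filter_sq_add_pow_four_eq_prime_sq_le x
  have h3 : ((#{ab ∈ Icc 1 x ×ˢ Icc 1 x | ab.1 ^ 2 + ab.2 ^ 4 ≤ x ∧
        (IsPrimePow (ab.1 ^ 2 + ab.2 ^ 4) ∧ ¬ (ab.1 ^ 2 + ab.2 ^ 4).Prime ∧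
          ¬ ((ab.1 ^ 2 + ab.2 ^ 4).sqrt.Prime ∧
            (ab.1 ^ 2 + ab.2 ^ 4).sqrt ^ 2 = ab.1 ^ 2 + ab.2 ^ 4))} : ℕ) : ℝ) ≤
      (#{p ∈ range (x + 1) | p ^ 3 ≤ x} * (Nat.log 2 x + 1) * x.sqrt.sqrt : ℕ) := by
    exact_mod_cast card_filter_sq_add_pow_four_eq_higher_prime_pow_le x
  have h2' := mul_le_mul_of_nonneg_left h2 hlogx
  have h3' := mul_le_mul_of_nonneg_left h3 hlogx
  push_cast at h2' h3' ⊢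
  linarith

/-- The prime-power part of the Friedlander–Iwaniec sum is `O(x^{2/3})`, explicitly: for `x ≥ 1`,
`log x · (2(2R + 1)² + #{p ≤ x : p³ ≤ x}(log₂ x + 1)R) ≤ 2784 x^{2/3}`, using `R ≤ x^{1/4}`,
`#{p : p³ ≤ x} ≤ x^{1/3} + 1`, `log₂ x ≤ 2 log x` and `log x ≤ 24 x^{1/24}`
(`Real.log_le_rpow_div`); with `q = x^{1/24} ≥ 1` this is the polynomial inequality
`24q(2(2q⁶ + 1)² + (q⁸ + 1)(48q + 1)q⁶) ≤ 2784 q¹⁶`. [folklore] -/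
theorem log_mul_card_le_rpow (x : ℕ) (hx : 1 ≤ x) :
    Real.log x * ((2 * (2 * x.sqrt.sqrt + 1) ^ 2 : ℕ) +
          (#{p ∈ range (x + 1) | p ^ 3 ≤ x} * (Nat.log 2 x + 1) * x.sqrt.sqrt : ℕ)) ≤
      2784 * (x : ℝ) ^ (2 / 3 : ℝ) := by
  have hx1 : (1 : ℝ) ≤ x := by exact_mod_cast hx
  have hx0 : (0 : ℝ) < x := by linarith
  have hR : (x.sqrt.sqrt : ℝ) ≤ (x : ℝ) ^ (1 / 4 : ℝ) := by
    have h4 : ((x.sqrt.sqrt : ℕ) : ℝ) ^ 4 ≤ x := by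
      have : x.sqrt.sqrt ^ 4 ≤ x := by
        calc x.sqrt.sqrt ^ 4 = (x.sqrt.sqrt ^ 2) ^ 2 := by ring
          _ ≤ x.sqrt ^ 2 := Nat.pow_le_pow_left (Nat.sqrt_le' _) 2
          _ ≤ x := Nat.sqrt_le' _
      exact_mod_cast this
    calc (x.sqrt.sqrt : ℝ) = (((x.sqrt.sqrt : ℝ)) ^ 4) ^ (4⁻¹ : ℝ) :=
          (Real.pow_rpow_inv_natCast (by positivity) (by norm_num)).symm
      _ ≤ (x : ℝ) ^ (4⁻¹ : ℝ) := Real.rpow_le_rpow (by positivity) h4 (by norm_num)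
      _ = (x : ℝ) ^ (1 / 4 : ℝ) := by norm_num
  have hP : (#{p ∈ range (x + 1) | p ^ 3 ≤ x} : ℝ) ≤ (x : ℝ) ^ (1 / 3 : ℝ) + 1 := by
    have hsub : {p ∈ range (x + 1) | p ^ 3 ≤ x} ⊆ range (⌊(x : ℝ) ^ (1 / 3 : ℝ)⌋₊ + 1) := by
      intro p hp
      simp only [mem_filter, mem_range] at hp
      rw [mem_range, Nat.lt_add_one_iff, Nat.le_floor_iff (by positivity)]
      have h3 : ((p : ℝ)) ^ 3 ≤ x := by exact_mod_cast hp.2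
      calc (p : ℝ) = (((p : ℝ)) ^ 3) ^ (3⁻¹ : ℝ) :=
          (Real.pow_rpow_inv_natCast (by positivity) (by norm_num)).symm
        _ ≤ (x : ℝ) ^ (3⁻¹ : ℝ) := Real.rpow_le_rpow (by positivity) h3 (by norm_num)
        _ = (x : ℝ) ^ (1 / 3 : ℝ) := by norm_num
    calc (#{p ∈ range (x + 1) | p ^ 3 ≤ x} : ℝ)
        ≤ (#(range (⌊(x : ℝ) ^ (1 / 3 : ℝ)⌋₊ + 1)) : ℝ) := by exact_mod_cast card_le_card hsub
      _ = ⌊(x : ℝ) ^ (1 / 3 : ℝ)⌋₊ + 1 := by rw [card_range]; push_cast; ring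
      _ ≤ (x : ℝ) ^ (1 / 3 : ℝ) + 1 := by gcongr; exact Nat.floor_le (by positivity)
  have hlog0 : 0 ≤ Real.log x := Real.log_natCast_nonneg x
  have hL : (Nat.log 2 x : ℝ) ≤ 2 * Real.log x := by
    have h2 : ((2 : ℕ) : ℝ) ^ Nat.log 2 x ≤ x := by
      exact_mod_cast Nat.pow_log_le_self 2 (by omega : x ≠ 0)
    have h2' : (Nat.log 2 x : ℝ) * Real.log 2 ≤ Real.log x := by
      rw [← Real.log_pow]
      exact Real.log_le_log (by positivity) (by exact_mod_cast h2)
    have hlog2 : (1 / 2 : ℝ) < Real.log 2 := by linarith [Real.log_two_gt_d9]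
    nlinarith [Nat.cast_nonneg (α := ℝ) (Nat.log 2 x)]
  have hlog : Real.log x ≤ 24 * (x : ℝ) ^ (1 / 24 : ℝ) := by
    have := Real.log_le_rpow_div hx0.le (by norm_num : (0 : ℝ) < 1 / 24)
    linarith [show (x : ℝ) ^ (1 / 24 : ℝ) / (1 / 24) = 24 * (x : ℝ) ^ (1 / 24 : ℝ) by ring]
  set q := (x : ℝ) ^ (1 / 24 : ℝ) with hq
  have hq1 : 1 ≤ q := Real.one_le_rpow hx1 (by norm_num)
  have h4 : (x : ℝ) ^ (1 / 4 : ℝ) = q ^ 6 := by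
    rw [hq, ← Real.rpow_natCast, ← Real.rpow_mul hx0.le]; norm_num
  have h3 : (x : ℝ) ^ (1 / 3 : ℝ) = q ^ 8 := by
    rw [hq, ← Real.rpow_natCast, ← Real.rpow_mul hx0.le]; norm_num
  have h23 : (x : ℝ) ^ (2 / 3 : ℝ) = q ^ 16 := by
    rw [hq, ← Real.rpow_natCast, ← Real.rpow_mul hx0.le]; norm_num
  rw [h4] at hR
  rw [h3] at hP
  rw [h23]
  push_cast
  set R := ((x.sqrt.sqrt : ℕ) : ℝ) with hRdef
  set P := ((#{p ∈ range (x + 1) | p ^ 3 ≤ x} : ℕ) : ℝ) with hPdef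
  set L := ((Nat.log 2 x : ℕ) : ℝ) with hLdef
  have hR0 : 0 ≤ R := by positivity
  have hP0 : 0 ≤ P := by positivity
  have hL0 : 0 ≤ L := by positivity
  have hL' : L + 1 ≤ 48 * q + 1 := by linarith
  calc Real.log x * (2 * (2 * R + 1) ^ 2 + P * (L + 1) * R)
      ≤ (24 * q) * (2 * (2 * q ^ 6 + 1) ^ 2 + (q ^ 8 + 1) * (48 * q + 1) * q ^ 6) := by
        gcongr
    _ ≤ 2784 * q ^ 16 := by
        nlinarith [pow_le_pow_right₀ hq1 (show 15 ≤ 16 by norm_num),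
          pow_le_pow_right₀ hq1 (show 13 ≤ 16 by norm_num),
          pow_le_pow_right₀ hq1 (show 8 ≤ 16 by norm_num),
          pow_le_pow_right₀ hq1 (show 7 ≤ 16 by norm_num),
          pow_le_pow_right₀ hq1 (show 1 ≤ 16 by norm_num)]

/-- **Friedlander–Iwaniec, Theorem 1 ⟹ infinitely many primes `a² + b⁴`** (the reduction of
parity.S17's qualitative form to its quantitative form). If
`∑∑_{a² + b⁴ ≤ x} Λ(a² + b⁴) ∼ 4π⁻¹κ x^{3/4}` (`friedlanderIwaniecSum_isEquivalent`, FI (1.1)), then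
`{p prime : p = a² + b⁴}` is infinite: otherwise all such primes are `≤ N₀`, the prime part of the
sum is `≤ N₀² log N₀` and the prime-power part is `≤ 2784 x^{2/3}` (`log_mul_card_le_rpow`), while
(1.1) with `κ > 0` gives `≥ 2π⁻¹κ x^{3/4}` for all large `x` — impossible as `x^{1/12} → ∞`. The
paper states the qualitative form as a consequence of Theorem 1 (§1: "there are infinitely many
primes of the form `a² + b⁴`, in fact getting the asymptotic formula"); the discharge
`setOf_prime_sq_add_pow_four_infinite_holds` is this theorem applied to the (future) discharge of
`friedlanderIwaniecSum_isEquivalent`. [cite: FriedlanderIwaniecAnnals1998, §1, Theorem 1 (1.1)–(1.2)] -/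
theorem setOf_prime_sq_add_pow_four_infinite_of_isEquivalent
    (h : friedlanderIwaniecSum_isEquivalent) : setOf_prime_sq_add_pow_four_infinite := by
  by_contra hfin
  have hfin' : {p : ℕ | p.Prime ∧ ∃ a b : ℕ, p = a ^ 2 + b ^ 4}.Finite := Set.not_infinite.mp hfin
  obtain ⟨N₀, hN₀⟩ := hfin'.bddAbove
  -- the prime part of the sum is bounded
  set M : ℝ := (N₀ : ℝ) ^ 2 * Real.log N₀ with hM
  have hM0 : 0 ≤ M := by positivity
  have hprime : ∀ x : ℕ,
      (∑ ab ∈ Icc 1 x ×ˢ Icc 1 x with (ab.1 ^ 2 + ab.2 ^ 4 ≤ x ∧ (ab.1 ^ 2 + ab.2 ^ 4).Prime),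
          Λ (ab.1 ^ 2 + ab.2 ^ 4)) ≤ M := by
    intro x
    have hsub : {ab ∈ Icc 1 x ×ˢ Icc 1 x | ab.1 ^ 2 + ab.2 ^ 4 ≤ x ∧ (ab.1 ^ 2 + ab.2 ^ 4).Prime} ⊆
        Icc 1 N₀ ×ˢ Icc 1 N₀ := by
      intro ab hab
      simp only [mem_filter, mem_product, mem_Icc] at hab ⊢
      obtain ⟨⟨⟨ha1, -⟩, ⟨hb1, -⟩⟩, -, hp⟩ := hab
      have hle : ab.1 ^ 2 + ab.2 ^ 4 ≤ N₀ := hN₀ ⟨hp, ab.1, ab.2, rfl⟩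
      refine ⟨⟨ha1, ?_⟩, ⟨hb1, ?_⟩⟩
      · exact le_trans (Nat.le_self_pow two_ne_zero _) (le_trans (Nat.le_add_right _ _) hle)
      · exact le_trans (Nat.le_self_pow (by norm_num) _) (le_trans (Nat.le_add_left _ _) hle)
    have hterm : ∀ ab ∈ {ab ∈ Icc 1 x ×ˢ Icc 1 x |
        ab.1 ^ 2 + ab.2 ^ 4 ≤ x ∧ (ab.1 ^ 2 + ab.2 ^ 4).Prime},
        Λ (ab.1 ^ 2 + ab.2 ^ 4) ≤ Real.log N₀ := by
      intro ab hab
      simp only [mem_filter, mem_product, mem_Icc] at hab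
      obtain ⟨-, -, hp⟩ := hab
      have hle : ab.1 ^ 2 + ab.2 ^ 4 ≤ N₀ := hN₀ ⟨hp, ab.1, ab.2, rfl⟩
      calc Λ (ab.1 ^ 2 + ab.2 ^ 4) ≤ Real.log (ab.1 ^ 2 + ab.2 ^ 4 : ℕ) :=
            ArithmeticFunction.vonMangoldt_le_log
        _ ≤ Real.log N₀ := Real.log_le_log (by exact_mod_cast hp.pos) (by exact_mod_cast hle)
    refine (Finset.sum_le_card_nsmul _ _ _ hterm).trans ?_
    rw [nsmul_eq_mul]
    have hcard : ((#{ab ∈ Icc 1 x ×ˢ Icc 1 x |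
        ab.1 ^ 2 + ab.2 ^ 4 ≤ x ∧ (ab.1 ^ 2 + ab.2 ^ 4).Prime} : ℕ) : ℝ) ≤ (N₀ : ℝ) * N₀ := by
      have := card_le_card hsub
      rw [card_product, Nat.card_Icc, Nat.add_sub_cancel] at this
      exact_mod_cast this
    have hlogN : 0 ≤ Real.log N₀ := Real.log_natCast_nonneg N₀
    rw [hM]
    nlinarith
  -- upper bound for `x ≥ 1`
  have hub : ∀ x : ℕ, 1 ≤ x → friedlanderIwaniecSum x ≤ M + 2784 * (x : ℝ) ^ (2 / 3 : ℝ) := by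
    intro x hx
    calc friedlanderIwaniecSum x ≤ _ := friedlanderIwaniecSum_le_sum_prime_add x
      _ ≤ M + 2784 * (x : ℝ) ^ (2 / 3 : ℝ) := add_le_add (hprime x) (log_mul_card_le_rpow x hx)
  -- lower bound, eventually, from the asymptotic formula
  set c : ℝ := 4 * Real.pi⁻¹ * friedlanderIwaniecKappa with hc
  have hc0 : 0 < c := by have := friedlanderIwaniecKappa_pos; positivity
  have hev : ∀ᶠ x : ℕ in atTop, c / 2 * (x : ℝ) ^ (3 / 4 : ℝ) ≤ friedlanderIwaniecSum x := by
    filter_upwards [h.isLittleO.bound (by norm_num : (0 : ℝ) < 1 / 2)] with x hx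
    have hg0 : 0 ≤ c * (x : ℝ) ^ (3 / 4 : ℝ) := by positivity
    simp only [Pi.sub_apply, Real.norm_eq_abs] at hx
    rw [abs_of_nonneg hg0] at hx
    have := (abs_le.mp hx).1
    linarith
  set K : ℝ := 2 * (M + 2784) / c with hK
  have hK' : ∀ᶠ x : ℕ in atTop, K < (x : ℝ) ^ (1 / 12 : ℝ) :=
    ((tendsto_rpow_atTop (by norm_num : (0 : ℝ) < 1 / 12)).comp
      tendsto_natCast_atTop_atTop).eventually_gt_atTop K
  obtain ⟨x, hx1, hxlo, hxK⟩ := ((eventually_ge_atTop 1).and (hev.and hK')).exists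
  have hx0 : (0 : ℝ) < x := by exact_mod_cast hx1
  have hx1' : (1 : ℝ) ≤ x := by exact_mod_cast hx1
  have h34 : (x : ℝ) ^ (3 / 4 : ℝ) = (x : ℝ) ^ (2 / 3 : ℝ) * (x : ℝ) ^ (1 / 12 : ℝ) := by
    rw [← Real.rpow_add hx0]; norm_num
  have h23 : 1 ≤ (x : ℝ) ^ (2 / 3 : ℝ) := Real.one_le_rpow hx1' (by norm_num)
  have hchain : c / 2 * (x : ℝ) ^ (3 / 4 : ℝ) ≤ (M + 2784) * (x : ℝ) ^ (2 / 3 : ℝ) := by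
    calc c / 2 * (x : ℝ) ^ (3 / 4 : ℝ) ≤ friedlanderIwaniecSum x := hxlo
      _ ≤ M + 2784 * (x : ℝ) ^ (2 / 3 : ℝ) := hub x hx1
      _ ≤ (M + 2784) * (x : ℝ) ^ (2 / 3 : ℝ) := by nlinarith
  rw [h34] at hchain
  have h12 : c / 2 * (x : ℝ) ^ (1 / 12 : ℝ) ≤ M + 2784 := by
    have hpos : (0 : ℝ) < (x : ℝ) ^ (2 / 3 : ℝ) := by positivity
    nlinarith
  have : (x : ℝ) ^ (1 / 12 : ℝ) ≤ K := by
    rw [hK, le_div_iff₀ hc0]; nlinarith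
  linarith

end FriedlanderIwaniec

/-! ### The "one fourth" of §4: `a_p = 4 #{a, b ≥ 1 : a² + b⁴ = p}` -/

section OneFourth

/-- The box `[−n, n]²` (`fiBox n`) in `fiRepCount` is exhaustive: `(a, c)` is counted iff
`a² + c⁴ = n` (as `|a| ≤ a² ≤ n` and `|c| ≤ c⁴ ≤ n`; cf. `mem_fiBox_of_eq`). [folklore] -/
theorem sq_add_pow_four_eq_iff_mem (n : ℕ) (a c : ℤ) :
    a ^ 2 + c ^ 4 = (n : ℤ) ↔
      (a, c) ∈ {ac ∈ Icc (-(n : ℤ)) n ×ˢ Icc (-(n : ℤ)) n | ac.1 ^ 2 + ac.2 ^ 4 = (n : ℤ)} := by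
  simp only [mem_filter, mem_product, mem_Icc]
  constructor
  · intro h
    have ha : (a.natAbs : ℤ) ≤ n := by
      have h1 := Int.natAbs_le_self_sq a
      nlinarith [sq_nonneg (c ^ 2)]
    have hc : (c.natAbs : ℤ) ≤ n := by
      have h1 := Int.natAbs_le_self_sq c
      have h2 : c ^ 2 ≤ c ^ 4 := by
        have h3 := Int.natAbs_le_self_sq (c ^ 2)
        rw [Int.natAbs_of_nonneg (sq_nonneg c)] at h3
        calc c ^ 2 ≤ (c ^ 2) ^ 2 := h3
          _ = c ^ 4 := by ring
      nlinarith [sq_nonneg a]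
    have ha' := abs_le.mp (show |a| ≤ (n : ℤ) by rw [← Int.natCast_natAbs]; exact ha)
    have hc' := abs_le.mp (show |c| ≤ (n : ℤ) by rw [← Int.natCast_natAbs]; exact hc)
    exact ⟨⟨⟨ha'.1, ha'.2⟩, ⟨hc'.1, hc'.2⟩⟩, h⟩
  · exact fun h => h.2

/-- A prime is neither a square nor a fourth power, so a solution of `a² + c⁴ = p` has `a ≠ 0`
and `c ≠ 0`. [folklore] -/
theorem ne_zero_of_sq_add_pow_four_eq_prime {p : ℕ} (hp : p.Prime) {a c : ℤ}
    (h : a ^ 2 + c ^ 4 = p) : a ≠ 0 ∧ c ≠ 0 := by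
  have hsq : ¬IsSquare (p : ℤ) := (Nat.prime_iff_prime_int.mp hp).not_isSquare
  constructor
  · rintro rfl
    apply hsq
    exact ⟨c ^ 2, by rw [← h]; ring⟩
  · rintro rfl
    apply hsq
    exact ⟨a, by rw [← h]; ring⟩

/-- **The "one fourth" of §4.** For a prime `p`, the integral solutions of `a² + c⁴ = p` are the
four sign variants `(±a, ±b)` of the solutions in positive integers (none has a zero coordinate,
`ne_zero_of_sq_add_pow_four_eq_prime`): `a_p = 4 · #{(a, b) : a, b ≥ 1, a² + b⁴ = p}`, the
positive solutions being collected from the (exhaustive) box `[1, p]²`. This is the factor by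
which the constant of Theorem 1 is "one fourth of that in (4.7)" (FI §4, after (4.8)).
[cite: FriedlanderIwaniecAnnals1998, §4, remark after (4.8)] -/
theorem fiRepCount_eq_four_mul_card {p : ℕ} (hp : p.Prime) :
    fiRepCount p = 4 * #{ab ∈ Icc 1 p ×ˢ Icc 1 p | ab.1 ^ 2 + ab.2 ^ 4 = p} := by
  classical
  set T : Finset (ℕ × ℕ) := {ab ∈ Icc 1 p ×ˢ Icc 1 p | ab.1 ^ 2 + ab.2 ^ 4 = p} with hT
  set S : Finset (ℤ × ℤ) :=
    {ac ∈ Icc (-(p : ℤ)) p ×ˢ Icc (-(p : ℤ)) p | ac.1 ^ 2 + ac.2 ^ 4 = (p : ℤ)} with hS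
  -- the signs
  let U : Finset ℤ := {1, -1}
  have hU : ∀ u ∈ U, u ^ 2 = 1 ∧ u.natAbs = 1 := by
    intro u hu
    simp only [U, mem_insert, mem_singleton] at hu
    rcases hu with rfl | rfl <;> simp
  have hUcard : #U = 2 := card_pair (by norm_num)
  have hsignU : ∀ z : ℤ, z ≠ 0 → z.sign ∈ U := by
    intro z hz
    rcases lt_or_gt_of_ne hz with hlt | hgt
    · simp [U, Int.sign_eq_neg_one_of_neg hlt]
    · simp [U, Int.sign_eq_one_of_pos hgt]
  let F : (ℕ × ℕ) × (ℤ × ℤ) → ℤ × ℤ := fun t => (t.2.1 * t.1.1, t.2.2 * t.1.2)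
  have hmemT : ∀ ab : ℕ × ℕ, ab ∈ T ↔ 1 ≤ ab.1 ∧ 1 ≤ ab.2 ∧ ab.1 ^ 2 + ab.2 ^ 4 = p := by
    intro ab
    simp only [hT, mem_filter, mem_product, mem_Icc]
    constructor
    · rintro ⟨⟨⟨h1, -⟩, ⟨h2, -⟩⟩, h⟩; exact ⟨h1, h2, h⟩
    · rintro ⟨h1, h2, h⟩
      refine ⟨⟨⟨h1, ?_⟩, ⟨h2, ?_⟩⟩, h⟩
      · calc ab.1 ≤ ab.1 ^ 2 := Nat.le_self_pow two_ne_zero _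
          _ ≤ p := by omega
      · calc ab.2 ≤ ab.2 ^ 4 := Nat.le_self_pow (by norm_num) _
          _ ≤ p := by omega
  -- `F` maps `T × U × U` onto `S`, injectively
  have himage : (T ×ˢ (U ×ˢ U)).image F = S := by
    ext ⟨a, c⟩
    simp only [mem_image, mem_product, Prod.exists]
    rw [hS, ← sq_add_pow_four_eq_iff_mem]
    constructor
    · rintro ⟨a', b', u, v, ⟨hab, hu, hv⟩, hF⟩
      rw [hmemT] at hab
      simp only [F, Prod.mk.injEq] at hF
      obtain ⟨rfl, rfl⟩ := hF
      have h' : ((a' : ℤ)) ^ 2 + ((b' : ℤ)) ^ 4 = (p : ℤ) := by exact_mod_cast hab.2.2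
      calc (u * (a' : ℤ)) ^ 2 + (v * (b' : ℤ)) ^ 4
          = u ^ 2 * (a' : ℤ) ^ 2 + (v ^ 2) ^ 2 * (b' : ℤ) ^ 4 := by ring
        _ = (p : ℤ) := by rw [(hU u hu).1, (hU v hv).1, ← h']; ring
    · intro h
      obtain ⟨ha0, hc0⟩ := ne_zero_of_sq_add_pow_four_eq_prime hp h
      refine ⟨a.natAbs, c.natAbs, a.sign, c.sign, ⟨?_, hsignU a ha0, hsignU c hc0⟩, ?_⟩
      · rw [hmemT]
        refine ⟨Int.natAbs_pos.mpr ha0, Int.natAbs_pos.mpr hc0, ?_⟩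
        have e4 : ((c.natAbs : ℤ)) ^ 4 = c ^ 4 := by
          calc ((c.natAbs : ℤ)) ^ 4 = (((c.natAbs : ℤ)) ^ 2) ^ 2 := by ring
            _ = (c ^ 2) ^ 2 := by rw [Int.natAbs_sq]
            _ = c ^ 4 := by ring
        have : ((a.natAbs : ℤ)) ^ 2 + ((c.natAbs : ℤ)) ^ 4 = (p : ℤ) := by
          rw [Int.natAbs_sq, e4]; exact h
        exact_mod_cast this
      · simp only [F, Int.sign_mul_natAbs]
  have hinj : Set.InjOn F ↑(T ×ˢ (U ×ˢ U)) := by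
    rintro ⟨⟨a₁, b₁⟩, u₁, v₁⟩ h₁ ⟨⟨a₂, b₂⟩, u₂, v₂⟩ h₂ hF
    simp only [coe_product, Set.mem_prod, mem_coe, hmemT] at h₁ h₂
    simp only [F, Prod.mk.injEq] at hF
    obtain ⟨hF1, hF2⟩ := hF
    have key : ∀ (u u' : ℤ) (m m' : ℕ), u ∈ U → u' ∈ U → 1 ≤ m →
        u * m = u' * m' → m = m' ∧ u = u' := by
      intro u u' m m' hu hu' hm h
      have habs := congrArg Int.natAbs h
      rw [Int.natAbs_mul, Int.natAbs_mul, (hU u hu).2, (hU u' hu').2, one_mul, one_mul,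
        Int.natAbs_natCast, Int.natAbs_natCast] at habs
      subst habs
      refine ⟨rfl, ?_⟩
      have hm0 : (m : ℤ) ≠ 0 := by exact_mod_cast (show m ≠ 0 by omega)
      exact mul_right_cancel₀ hm0 h
    obtain ⟨rfl, rfl⟩ := key u₁ u₂ a₁ a₂ h₁.2.1 h₂.2.1 h₁.1.1 hF1
    obtain ⟨rfl, rfl⟩ := key v₁ v₂ b₁ b₂ h₁.2.2 h₂.2.2 h₁.1.2.1 hF2
    rfl
  rw [fiRepCount, fiBox, ← hS, ← himage, card_image_of_injOn hinj, card_product, card_product,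
    hUcard, hT]
  ring

end OneFourth

/-! ### Theorem 1 as printed and its `∼` form -/

section PrintedForm

/-- `log log x / log x → 0` along the natural numbers (from Mathlib's `log y = o(y)` composed with
`log x → ∞`). [folklore] -/
theorem tendsto_log_log_div_log_natCast :
    Tendsto (fun x : ℕ => Real.log (Real.log x) / Real.log x) atTop (nhds 0) := by
  have h1 : Tendsto (fun y : ℝ => Real.log y / y) atTop (nhds 0) :=
    Real.isLittleO_log_id_atTop.tendsto_div_nhds_zero
  exact (h1.comp Real.tendsto_log_atTop).comp tendsto_natCast_atTop_atTop

/-- Theorem 1 as printed (the `IsBigO` form with its error term) implies its `∼` form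
(parity.S17, quantitative clause): `u − v = O(v · ε(x))` with `ε(x) = log log x / log x → 0`
gives `u − v = o(v)`, i.e. `u ∼ v`. [cite: FriedlanderIwaniecAnnals1998, §1 Theorem 1 (1.1)] -/
theorem friedlanderIwaniecSum_isEquivalent_of_isBigO
    (h : (fun x : ℕ => friedlanderIwaniecSum x -
        4 * Real.pi⁻¹ * friedlanderIwaniecKappa * (x : ℝ) ^ (3 / 4 : ℝ)) =O[atTop]
      fun x : ℕ => (x : ℝ) ^ (3 / 4 : ℝ) * (Real.log (Real.log x) / Real.log x)) :
    friedlanderIwaniecSum_isEquivalent := by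
  unfold friedlanderIwaniecSum_isEquivalent
  have hlo : (fun x : ℕ => (x : ℝ) ^ (3 / 4 : ℝ) * (Real.log (Real.log x) / Real.log x)) =o[atTop]
      fun x : ℕ => 4 * Real.pi⁻¹ * friedlanderIwaniecKappa * (x : ℝ) ^ (3 / 4 : ℝ) := by
    have hc : (4 * Real.pi⁻¹ * friedlanderIwaniecKappa) ≠ 0 := by
      have hκ := friedlanderIwaniecKappa_pos
      positivity
    have h2 : (fun x : ℕ => (x : ℝ) ^ (3 / 4 : ℝ) * (Real.log (Real.log x) / Real.log x)) =o[atTop]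
        fun x : ℕ => (x : ℝ) ^ (3 / 4 : ℝ) * (1 : ℝ) :=
      (isBigO_refl (fun x : ℕ => (x : ℝ) ^ (3 / 4 : ℝ)) atTop).mul_isLittleO
        ((isLittleO_one_iff ℝ).mpr tendsto_log_log_div_log_natCast)
    simp only [mul_one] at h2
    exact h2.trans_isBigO (isBigO_self_const_mul hc _ atTop)
  rw [Asymptotics.IsEquivalent]
  exact h.trans_isLittleO hlo

end PrintedForm

/-! ### From (4.2) and (4.7)–(4.8) to Theorem 1 (FI §4, after (4.8)) -/

section Assembly

open Filter Asymptotics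
open scoped ArithmeticFunction.vonMangoldt

/-- The prime part of the Friedlander–Iwaniec sum is one fourth of `S(x)`:
`∑∑_{a, b ≥ 1, a² + b⁴ = p ≤ x} Λ(a² + b⁴) = ¼ ∑_{p ≤ x} a_p log p`, by regrouping the pairs
according to the prime `p = a² + b⁴` (`Finset.sum_fiberwise_of_maps_to`), `Λ(p) = log p`, and
`a_p = 4 #{a, b ≥ 1 : a² + b⁴ = p}` (`fiRepCount_eq_four_mul_card`) — the "one fourth" of FI §4.
[cite: FriedlanderIwaniecAnnals1998, §4, remark after (4.8)] -/
theorem sum_prime_part_eq_fiPrimeSum_div_four (x : ℕ) :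
    (∑ ab ∈ Icc 1 x ×ˢ Icc 1 x with (ab.1 ^ 2 + ab.2 ^ 4 ≤ x ∧ (ab.1 ^ 2 + ab.2 ^ 4).Prime),
        Λ (ab.1 ^ 2 + ab.2 ^ 4)) = fiPrimeSum x / 4 := by
  rw [fiPrimeSum, Nat.floor_natCast]
  set s := {ab ∈ Icc 1 x ×ˢ Icc 1 x | ab.1 ^ 2 + ab.2 ^ 4 ≤ x ∧ (ab.1 ^ 2 + ab.2 ^ 4).Prime}
    with hs
  have hmaps : ∀ ab ∈ s, ab.1 ^ 2 + ab.2 ^ 4 ∈ Nat.primesLE x := by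
    intro ab hab
    simp only [hs, mem_filter] at hab
    exact Nat.mem_primesLE.mpr ⟨hab.2.1, hab.2.2⟩
  rw [← Finset.sum_fiberwise_of_maps_to hmaps, eq_div_iff (by norm_num : (4 : ℝ) ≠ 0),
    Finset.sum_mul]
  refine Finset.sum_congr rfl fun p hp => ?_
  have hp' := Nat.mem_primesLE.mp hp
  have hinner : ∑ ab ∈ s with ab.1 ^ 2 + ab.2 ^ 4 = p, Λ (ab.1 ^ 2 + ab.2 ^ 4) =
      ∑ ab ∈ s with ab.1 ^ 2 + ab.2 ^ 4 = p, Real.log p := by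
    refine Finset.sum_congr rfl fun ab hab => ?_
    rw [(mem_filter.mp hab).2, ArithmeticFunction.vonMangoldt_apply_prime hp'.2]
  have hfilter : {ab ∈ s | ab.1 ^ 2 + ab.2 ^ 4 = p} =
      {ab ∈ Icc 1 p ×ˢ Icc 1 p | ab.1 ^ 2 + ab.2 ^ 4 = p} := by
    ext ab
    simp only [hs, mem_filter, mem_product, mem_Icc]
    constructor
    · rintro ⟨⟨⟨⟨ha1, -⟩, ⟨hb1, -⟩⟩, -, -⟩, h⟩
      refine ⟨⟨⟨ha1, ?_⟩, ⟨hb1, ?_⟩⟩, h⟩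
      · calc ab.1 ≤ ab.1 ^ 2 := Nat.le_self_pow two_ne_zero _
          _ ≤ p := by omega
      · calc ab.2 ≤ ab.2 ^ 4 := Nat.le_self_pow (by norm_num) _
          _ ≤ p := by omega
    · rintro ⟨⟨⟨ha1, -⟩, ⟨hb1, -⟩⟩, h⟩
      refine ⟨⟨⟨⟨ha1, ?_⟩, ⟨hb1, ?_⟩⟩, h ▸ hp'.1, h ▸ hp'.2⟩, h⟩
      · calc ab.1 ≤ ab.1 ^ 2 := Nat.le_self_pow two_ne_zero _
          _ ≤ x := by omega
      · calc ab.2 ≤ ab.2 ^ 4 := Nat.le_self_pow (by norm_num) _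
          _ ≤ x := by omega
  rw [hinner, Finset.sum_const, nsmul_eq_mul, hfilter, fiRepCount_eq_four_mul_card hp'.2]
  push_cast
  ring

/-- The prime part is at most the whole Friedlander–Iwaniec sum (all terms `Λ ≥ 0`). [folklore] -/
theorem sum_prime_part_le_friedlanderIwaniecSum (x : ℕ) :
    (∑ ab ∈ Icc 1 x ×ˢ Icc 1 x with (ab.1 ^ 2 + ab.2 ^ 4 ≤ x ∧ (ab.1 ^ 2 + ab.2 ^ 4).Prime),
        Λ (ab.1 ^ 2 + ab.2 ^ 4)) ≤ friedlanderIwaniecSum x := by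
  have hsum : friedlanderIwaniecSum x =
      ∑ ab ∈ Icc 1 x ×ˢ Icc 1 x,
        (if ab.1 ^ 2 + ab.2 ^ 4 ≤ x then Λ (ab.1 ^ 2 + ab.2 ^ 4) else 0) := by
    rw [friedlanderIwaniecSum, Finset.sum_product]
  rw [hsum, Finset.sum_filter]
  refine Finset.sum_le_sum fun ab _ => ?_
  have h0 : 0 ≤ Λ (ab.1 ^ 2 + ab.2 ^ 4) := ArithmeticFunction.vonMangoldt_nonneg
  by_cases h1 : ab.1 ^ 2 + ab.2 ^ 4 ≤ x ∧ (ab.1 ^ 2 + ab.2 ^ 4).Prime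
  · rw [if_pos h1, if_pos h1.1]
  · rw [if_neg h1]
    split_ifs
    · exact h0
    · exact le_rfl

/-- **FI §4: "(4.7), (4.8) and (4.2) yield the asymptotic formula (1.1) of our main theorem" —
with the printed error term.**
From `A(x) = 4κ x^{3/4} + O(x^{1/2})` (4.2) and `S(x) = (4/π) A(x) (1 + O(log log x / log x))`
((4.7)–(4.8)) to Theorem 1: for integer `x`,
`∑∑ Λ(a² + b⁴) = ¼ S(x) + E(x)` with `0 ≤ E(x) ≤ 2784 x^{2/3}` the prime-power part
(`sum_prime_part_eq_fiPrimeSum_div_four`, `sum_prime_part_le_friedlanderIwaniecSum`,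
`friedlanderIwaniecSum_le_sum_prime_add`, `log_mul_card_le_rpow`), so
`∑∑ Λ(a² + b⁴) − 4π⁻¹κ x^{3/4} = E + ¼ (S − (4/π) A) + π⁻¹ (A − 4κ x^{3/4})
 = O(x^{2/3}) + O(x^{3/4} log log x / log x) + O(x^{1/2})`, using `A(x) = O(x^{3/4})` (from (4.2))
and `x^{2/3} log x ≤ 12 x^{3/4} ≤ 12 x^{3/4} log log x` for large `x`.
[cite: FriedlanderIwaniecAnnals1998, §4 (4.2), (4.7)–(4.8) and §1 Theorem 1] -/
theorem friedlanderIwaniecSum_isBigO_of_count_of_primeSum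
    (h42 : FriedlanderIwaniec1998_count_asymp) (h47 : FriedlanderIwaniec1998_primeSum_asymp) :
    (fun x : ℕ => friedlanderIwaniecSum x -
        4 * Real.pi⁻¹ * friedlanderIwaniecKappa * (x : ℝ) ^ (3 / 4 : ℝ)) =O[atTop]
      fun x : ℕ => (x : ℝ) ^ (3 / 4 : ℝ) * (Real.log (Real.log x) / Real.log x) := by
  unfold FriedlanderIwaniec1998_count_asymp at h42
  unfold FriedlanderIwaniec1998_primeSum_asymp at h47
  set g : ℕ → ℝ := fun x => (x : ℝ) ^ (3 / 4 : ℝ) * (Real.log (Real.log x) / Real.log x) with hg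
  -- the two facts along integer `x`
  have h42' : (fun x : ℕ => fiCount x - 4 * friedlanderIwaniecKappa * (x : ℝ) ^ (3 / 4 : ℝ))
      =O[atTop] fun x : ℕ => (x : ℝ) ^ (1 / 2 : ℝ) :=
    h42.comp_tendsto tendsto_natCast_atTop_atTop
  have h47' : (fun x : ℕ => fiPrimeSum x - 4 / Real.pi * fiCount x) =O[atTop]
      fun x : ℕ => 4 / Real.pi * fiCount x * (Real.log (Real.log x) / Real.log x) :=
    h47.comp_tendsto tendsto_natCast_atTop_atTop
  -- `log log x ≥ 1` and `x^{2/3} ≤ 12 g(x)` eventually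
  have hloglog : ∀ᶠ x : ℕ in atTop, 1 ≤ Real.log (Real.log x) :=
    ((Real.tendsto_log_atTop.comp Real.tendsto_log_atTop).comp
      tendsto_natCast_atTop_atTop).eventually_ge_atTop 1
  have hg_nonneg : ∀ᶠ x : ℕ in atTop, 0 ≤ g x := by
    filter_upwards [hloglog, eventually_gt_atTop 1] with x hll hx1
    have hx : (1 : ℝ) < x := by exact_mod_cast hx1
    have := Real.log_pos hx
    simp only [hg]
    positivity
  have hsmall : ∀ᶠ x : ℕ in atTop, (x : ℝ) ^ (2 / 3 : ℝ) ≤ 12 * g x := by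
    filter_upwards [hloglog, eventually_gt_atTop 1] with x hll hx1
    have hx : (1 : ℝ) < x := by exact_mod_cast hx1
    have hx0 : (0 : ℝ) < x := by linarith
    have hlogpos : 0 < Real.log x := Real.log_pos hx
    have hlog : Real.log x ≤ 12 * (x : ℝ) ^ (1 / 12 : ℝ) := by
      have := Real.log_le_rpow_div hx0.le (by norm_num : (0 : ℝ) < 1 / 12)
      linarith [show (x : ℝ) ^ (1 / 12 : ℝ) / (1 / 12) = 12 * (x : ℝ) ^ (1 / 12 : ℝ) by ring]
    have h34 : (x : ℝ) ^ (3 / 4 : ℝ) = (x : ℝ) ^ (2 / 3 : ℝ) * (x : ℝ) ^ (1 / 12 : ℝ) := by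
      rw [← Real.rpow_add hx0]; norm_num
    have key : (x : ℝ) ^ (2 / 3 : ℝ) * Real.log x ≤
        12 * (x : ℝ) ^ (3 / 4 : ℝ) * Real.log (Real.log x) := by
      calc (x : ℝ) ^ (2 / 3 : ℝ) * Real.log x
          ≤ (x : ℝ) ^ (2 / 3 : ℝ) * (12 * (x : ℝ) ^ (1 / 12 : ℝ)) := by gcongr
        _ = 12 * (x : ℝ) ^ (3 / 4 : ℝ) * 1 := by rw [h34]; ring
        _ ≤ 12 * (x : ℝ) ^ (3 / 4 : ℝ) * Real.log (Real.log x) := by gcongr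
    calc (x : ℝ) ^ (2 / 3 : ℝ) = (x : ℝ) ^ (2 / 3 : ℝ) * Real.log x / Real.log x := by
          field_simp
      _ ≤ 12 * (x : ℝ) ^ (3 / 4 : ℝ) * Real.log (Real.log x) / Real.log x := by gcongr
      _ = 12 * g x := by simp only [hg]; ring
  -- E1: the prime-power part is `O(g)`
  have E1 : (fun x : ℕ => friedlanderIwaniecSum x -
      ∑ ab ∈ Icc 1 x ×ˢ Icc 1 x with (ab.1 ^ 2 + ab.2 ^ 4 ≤ x ∧ (ab.1 ^ 2 + ab.2 ^ 4).Prime),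
        Λ (ab.1 ^ 2 + ab.2 ^ 4)) =O[atTop] g := by
    refine IsBigO.of_bound (2784 * 12) ?_
    filter_upwards [hsmall, hg_nonneg, eventually_ge_atTop 1] with x hs hg0 hx1
    have hlo := sum_prime_part_le_friedlanderIwaniecSum x
    have hhi := (friedlanderIwaniecSum_le_sum_prime_add x).trans
      (add_le_add le_rfl (log_mul_card_le_rpow x hx1))
    rw [Real.norm_eq_abs, Real.norm_eq_abs, abs_of_nonneg (by linarith), abs_of_nonneg hg0]
    nlinarith
  -- `A(x) = O(x^{3/4})`
  have hA : (fun x : ℕ => fiCount x) =O[atTop] fun x : ℕ => (x : ℝ) ^ (3 / 4 : ℝ) := by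
    have h1 : (fun x : ℕ => (x : ℝ) ^ (1 / 2 : ℝ)) =O[atTop] fun x : ℕ => (x : ℝ) ^ (3 / 4 : ℝ) := by
      refine IsBigO.of_bound 1 ?_
      filter_upwards [eventually_ge_atTop 1] with x hx1
      have hx : (1 : ℝ) ≤ x := by exact_mod_cast hx1
      rw [one_mul, Real.norm_of_nonneg (by positivity), Real.norm_of_nonneg (by positivity)]
      exact Real.rpow_le_rpow_of_exponent_le hx (by norm_num)
    have h2 : (fun x : ℕ => 4 * friedlanderIwaniecKappa * (x : ℝ) ^ (3 / 4 : ℝ)) =O[atTop]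
        fun x : ℕ => (x : ℝ) ^ (3 / 4 : ℝ) := isBigO_const_mul_self _ _ _
    have := (h42'.trans h1).add h2
    simpa using this
  -- E3: `¼ (S − (4/π) A) = O(g)`
  have hAr : (fun x : ℕ => 4 / Real.pi * fiCount x * (Real.log (Real.log x) / Real.log x))
      =O[atTop] g :=
    ((hA.mul (isBigO_refl (fun x : ℕ => Real.log (Real.log x) / Real.log x)
      atTop)).const_mul_left (4 / Real.pi)).congr_left fun x => by ring
  have E3 : (fun x : ℕ => (1 / 4 : ℝ) * (fiPrimeSum x - 4 / Real.pi * fiCount x)) =O[atTop] g :=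
    (h47'.trans hAr).const_mul_left (1 / 4 : ℝ)
  -- E4: `π⁻¹ (A − 4κ x^{3/4}) = O(g)`
  have E4 : (fun x : ℕ => Real.pi⁻¹ *
      (fiCount x - 4 * friedlanderIwaniecKappa * (x : ℝ) ^ (3 / 4 : ℝ))) =O[atTop] g := by
    have h1 : (fun x : ℕ => (x : ℝ) ^ (1 / 2 : ℝ)) =O[atTop] g := by
      refine IsBigO.of_bound 12 ?_
      filter_upwards [hsmall, hg_nonneg, eventually_ge_atTop 1] with x hs hg0 hx1
      have hx : (1 : ℝ) ≤ x := by exact_mod_cast hx1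
      rw [Real.norm_of_nonneg (by positivity), Real.norm_of_nonneg hg0]
      exact (Real.rpow_le_rpow_of_exponent_le hx (by norm_num)).trans hs
    exact (h42'.trans h1).const_mul_left _
  -- assemble
  refine ((E1.add E3).add E4).congr' ?_ EventuallyEq.rfl
  filter_upwards with x
  rw [sum_prime_part_eq_fiPrimeSum_div_four x]
  ring

end Assembly

/-! ### Discharge of (2.2): `A(x) ≫ x^{1/3} (∑_{n ≤ x} a_n²)^{1/2}` ("obvious in our case", §3)

`∑_{n ≤ x} a_n²` counts the quadruples `(a, c, a', c')` with `a² + c⁴ = a'² + c'⁴ ≤ x`. Those with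
`c' = ±c` have `a' = ±a`, at most `4 A(x) ≪ x^{3/4}` of them; for the others
`m = c'⁴ − c⁴ ≠ 0` and `(a − a')(a + a') = m`, so `(a, a')` is determined by a signed divisor of
`m`: at most `2τ(|m|) ≪ |m|^{1/4} ≪ x^{1/4}` pairs for each of the `O(x^{1/2})` pairs `(c, c')`.
Hence `∑_{n ≤ x} a_n² ≪ x^{3/4}` and `x^{1/3} (∑ a_n²)^{1/2} ≪ x^{17/24} = o(A(x))`. -/

section Hyp22

/-- `(|c|⁴ : ℤ) = c⁴`. [folklore] -/
theorem natAbs_pow_four_cast (c : ℤ) : ((c.natAbs : ℤ)) ^ 4 = c ^ 4 := by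
  calc ((c.natAbs : ℤ)) ^ 4 = (((c.natAbs : ℤ)) ^ 2) ^ 2 := by ring
    _ = (c ^ 2) ^ 2 := by rw [Int.natAbs_sq]
    _ = c ^ 4 := by ring

/-- The integer solutions of `a² − a'² = m` (`m ≠ 0`) in any box number at most `2τ(|m|)`:
`(a − a', a + a')` is a (signed) complementary pair of divisors of `m`. [folklore] -/
theorem card_filter_sq_sub_sq_eq_le (B : Finset ℤ) {m : ℤ} (hm : m ≠ 0) :
    #{aa ∈ B ×ˢ B | aa.1 ^ 2 - aa.2 ^ 2 = m} ≤ 2 * m.natAbs.divisors.card := by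
  let F : ℕ × ℤ → ℤ × ℤ := fun ds =>
    ((ds.2 * ds.1 + m / (ds.2 * ds.1)) / 2, (m / (ds.2 * ds.1) - ds.2 * ds.1) / 2)
  have hsub : {aa ∈ B ×ˢ B | aa.1 ^ 2 - aa.2 ^ 2 = m} ⊆
      (m.natAbs.divisors ×ˢ ({1, -1} : Finset ℤ)).image F := by
    rintro ⟨a, a'⟩ h
    rw [mem_filter, mem_product] at h
    obtain ⟨-, hEq⟩ := h
    have huv : (a - a') * (a + a') = m := by rw [← hEq]; ring
    have hu0 : a - a' ≠ 0 := by
      intro h0; rw [h0, zero_mul] at huv; exact hm huv.symm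
    rw [mem_image]
    refine ⟨((a - a').natAbs, Int.sign (a - a')), ?_, ?_⟩
    · rw [mem_product, Nat.mem_divisors, mem_insert, mem_singleton]
      refine ⟨⟨Int.natAbs_dvd_natAbs.mpr ⟨a + a', huv.symm⟩, Int.natAbs_ne_zero.mpr hm⟩, ?_⟩
      rcases lt_or_gt_of_ne hu0 with h | h
      · exact Or.inr (Int.sign_eq_neg_one_of_neg h)
      · exact Or.inl (Int.sign_eq_one_of_pos h)
    · have hsu : Int.sign (a - a') * ((a - a').natAbs : ℤ) = a - a' := Int.sign_mul_natAbs _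
      have hvu : m / (a - a') = a + a' := by
        rw [← huv, mul_comm]; exact Int.mul_ediv_cancel _ hu0
      show ((Int.sign (a - a') * ((a - a').natAbs : ℤ) + m / (Int.sign (a - a') *
          ((a - a').natAbs : ℤ))) / 2, (m / (Int.sign (a - a') * ((a - a').natAbs : ℤ)) -
          Int.sign (a - a') * ((a - a').natAbs : ℤ)) / 2) = (a, a')
      rw [hsu, hvu, Prod.mk.injEq]
      constructor <;> omega
  calc _ ≤ #((m.natAbs.divisors ×ˢ ({1, -1} : Finset ℤ)).image F) := card_le_card hsub
    _ ≤ #(m.natAbs.divisors ×ˢ ({1, -1} : Finset ℤ)) := card_image_le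
    _ = 2 * m.natAbs.divisors.card := by rw [card_product, card_pair (by norm_num)]; ring

/-- `c'⁴ = c⁴` forces `c' = ±c` (integers). [folklore] -/
theorem eq_or_eq_neg_of_pow_four_eq {c c' : ℤ} (h : c' ^ 4 = c ^ 4) : c' = c ∨ c' = -c := by
  have h' : c'.natAbs ^ 4 = c.natAbs ^ 4 := by
    have := congrArg Int.natAbs h
    rwa [Int.natAbs_pow, Int.natAbs_pow] at this
  exact Int.natAbs_eq_natAbs_iff.mp (Nat.pow_left_injective (by norm_num) h')

/-- The "diagonal" pairs of solutions of `a² + c⁴ = n`, those `((a, c), (a', c'))` with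
`c' = ±c` (hence `a' = ±a`), number at most `4 a_n`. [folklore] -/
theorem card_solutions_sq_diag_le (n : ℕ) :
    #{q ∈ {ac ∈ fiBox n | ac.1 ^ 2 + ac.2 ^ 4 = (n : ℤ)} ×ˢ {ac ∈ fiBox n | ac.1 ^ 2 + ac.2 ^ 4 = (n : ℤ)} | (q.2.2 = q.1.2 ∨ q.2.2 = -q.1.2)} ≤
      4 * fiRepCount n := by
  let U : Finset (ℤ × ℤ) := ({1, -1} : Finset ℤ) ×ˢ ({1, -1} : Finset ℤ)
  let G : (ℤ × ℤ) × (ℤ × ℤ) → (ℤ × ℤ) × (ℤ × ℤ) := fun p =>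
    (p.1, (p.2.1 * p.1.1, p.2.2 * p.1.2))
  have hsub : {q ∈ {ac ∈ fiBox n | ac.1 ^ 2 + ac.2 ^ 4 = (n : ℤ)} ×ˢ {ac ∈ fiBox n | ac.1 ^ 2 + ac.2 ^ 4 = (n : ℤ)} | (q.2.2 = q.1.2 ∨ q.2.2 = -q.1.2)} ⊆
      ({ac ∈ fiBox n | ac.1 ^ 2 + ac.2 ^ 4 = (n : ℤ)} ×ˢ U).image G := by
    rintro ⟨⟨a, c⟩, ⟨a', c'⟩⟩ hq
    simp only [mem_filter, mem_product] at hq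
    obtain ⟨⟨⟨hacB, e1⟩, ⟨-, e2⟩⟩, hP⟩ := hq
    have hac : (a, c) ∈ ({ac ∈ fiBox n | ac.1 ^ 2 + ac.2 ^ 4 = (n : ℤ)} : Finset (ℤ × ℤ)) :=
      mem_filter.mpr ⟨hacB, e1⟩
    have hc4 : c' ^ 4 = c ^ 4 := by obtain h | h := hP <;> subst h <;> ring
    have ha2 : a' ^ 2 = a ^ 2 := by linarith
    rw [mem_image]
    rcases sq_eq_sq_iff_eq_or_eq_neg.mp ha2 with ha | ha <;> rcases hP with hc | hc
    · exact ⟨((a, c), (1, 1)), mem_product.mpr ⟨hac, by simp [U]⟩, by simp [G, ha, hc]⟩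
    · exact ⟨((a, c), (1, -1)), mem_product.mpr ⟨hac, by simp [U]⟩, by simp [G, ha, hc]⟩
    · exact ⟨((a, c), (-1, 1)), mem_product.mpr ⟨hac, by simp [U]⟩, by simp [G, ha, hc]⟩
    · exact ⟨((a, c), (-1, -1)), mem_product.mpr ⟨hac, by simp [U]⟩, by simp [G, ha, hc]⟩
  have hU : #U = 4 := by
    simp only [U, card_product, card_pair (show (1 : ℤ) ≠ -1 by norm_num)]
  calc _ ≤ #(({ac ∈ fiBox n | ac.1 ^ 2 + ac.2 ^ 4 = (n : ℤ)} ×ˢ U).image G) := card_le_card hsub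
    _ ≤ #({ac ∈ fiBox n | ac.1 ^ 2 + ac.2 ^ 4 = (n : ℤ)} ×ˢ U) := card_image_le
    _ = 4 * fiRepCount n := by rw [card_product, hU, fiRepCount]; ring

/-- The "off-diagonal" pairs of solutions of `a² + c⁴ = n` (`c' ≠ ±c`), `1 ≤ n ≤ N`, inject into the
fibre over `n` of the set of all off-diagonal quadruples `a² + c⁴ = a'² + c'⁴ ∈ [1, N]` in the
box `[−N, N]⁴`. [folklore] -/
theorem card_solutions_sq_offdiag_le {N n : ℕ} (hn : n ∈ Icc 1 N) :
    #{q ∈ {ac ∈ fiBox n | ac.1 ^ 2 + ac.2 ^ 4 = (n : ℤ)} ×ˢ {ac ∈ fiBox n | ac.1 ^ 2 + ac.2 ^ 4 = (n : ℤ)} | ¬(q.2.2 = q.1.2 ∨ q.2.2 = -q.1.2)} ≤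
      #{q ∈ {q ∈ fiBox N ×ˢ fiBox N | q.1.1 ^ 2 + q.1.2 ^ 4 = q.2.1 ^ 2 + q.2.2 ^ 4 ∧
        ¬(q.2.2 = q.1.2 ∨ q.2.2 = -q.1.2) ∧ 1 ≤ q.1.1 ^ 2 + q.1.2 ^ 4 ∧
        q.1.1 ^ 2 + q.1.2 ^ 4 ≤ (N : ℤ)} | (q.1.1 ^ 2 + q.1.2 ^ 4).toNat = n} := by
  rw [mem_Icc] at hn
  refine card_le_card ?_
  rintro ⟨⟨a, c⟩, ⟨a', c'⟩⟩ hq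
  simp only [mem_filter, mem_product] at hq
  obtain ⟨⟨⟨-, e1⟩, ⟨-, e2⟩⟩, hP⟩ := hq
  have hnN : (n : ℤ) ≤ N := by exact_mod_cast hn.2
  have hn1 : (1 : ℤ) ≤ n := by exact_mod_cast hn.1
  rw [mem_filter, mem_filter, mem_product]
  refine ⟨⟨⟨mem_fiBox_of_eq e1 hn.2, mem_fiBox_of_eq e2 hn.2⟩, ?_, hP, ?_, ?_⟩, ?_⟩
  · show a ^ 2 + c ^ 4 = a' ^ 2 + c' ^ 4
    rw [e1, e2]
  · show 1 ≤ a ^ 2 + c ^ 4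
    rw [e1]; exact hn1
  · show a ^ 2 + c ^ 4 ≤ (N : ℤ)
    rw [e1]; exact hnN
  · show (a ^ 2 + c ^ 4).toNat = n
    rw [e1]; exact Int.toNat_natCast n

/-- The off-diagonal quadruples `a² + c⁴ = a'² + c'⁴ ∈ [1, N]`, `c' ≠ ±c`, number at most
`2C (2N)^{1/4} (2⌊N^{1/4}⌋ + 1)²` when `τ(m) ≤ C m^{1/4}`: for each of the `≤ (2⌊N^{1/4}⌋ + 1)²`
pairs `(c, c')` the pair `(a, a')` solves `a² − a'² = c'⁴ − c⁴ ≠ 0`, `|c'⁴ − c⁴| ≤ 2N`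
(`card_filter_sq_sub_sq_eq_le`). [folklore] -/
theorem card_offdiag_quadruples_le (N : ℕ) {C : ℝ}
    (hC : ∀ m : ℕ, m ≠ 0 → (#m.divisors : ℝ) ≤ C * (m : ℝ) ^ (1 / 4 : ℝ)) :
    (#{q ∈ fiBox N ×ˢ fiBox N | q.1.1 ^ 2 + q.1.2 ^ 4 = q.2.1 ^ 2 + q.2.2 ^ 4 ∧
        ¬(q.2.2 = q.1.2 ∨ q.2.2 = -q.1.2) ∧ 1 ≤ q.1.1 ^ 2 + q.1.2 ^ 4 ∧
        q.1.1 ^ 2 + q.1.2 ^ 4 ≤ (N : ℤ)} : ℝ) ≤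
      2 * C * (2 * N : ℝ) ^ (1 / 4 : ℝ) * (2 * Nat.sqrt (Nat.sqrt N) + 1) ^ 2 := by
  set R : ℕ := Nat.sqrt (Nat.sqrt N) with hR
  set Bc : Finset ℤ := Icc (-(R : ℤ)) R with hBc
  have hC0 : 0 ≤ C := by
    have := hC 1 one_ne_zero
    simp at this; linarith
  -- |c| ≤ R whenever c⁴ ≤ N, and conversely c⁴ ≤ N on Bc
  have hbox : ∀ c : ℤ, c ^ 4 ≤ (N : ℤ) → c ∈ Bc := by
    intro c hc
    have h1 : c.natAbs ^ 4 ≤ N := by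
      have : ((c.natAbs ^ 4 : ℕ) : ℤ) ≤ N := by
        rw [Nat.cast_pow, natAbs_pow_four_cast]; exact hc
      exact_mod_cast this
    have h3 : c.natAbs ≤ R := by
      rw [hR, Nat.le_sqrt', Nat.le_sqrt']
      calc (c.natAbs ^ 2) ^ 2 = c.natAbs ^ 4 := by ring
        _ ≤ N := h1
    have h4 : |c| ≤ (R : ℤ) := by rw [← Int.natCast_natAbs]; exact_mod_cast h3
    rw [hBc, mem_Icc]; exact abs_le.mp h4
  have hc4 : ∀ c ∈ Bc, c ^ 4 ≤ (N : ℤ) := by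
    intro c hcB
    rw [hBc, mem_Icc] at hcB
    have habs : c.natAbs ≤ R := by
      have : |c| ≤ (R : ℤ) := abs_le.mpr hcB
      rw [← Int.natCast_natAbs] at this; exact_mod_cast this
    have h4 : c.natAbs ^ 4 ≤ N := by
      calc c.natAbs ^ 4 = (c.natAbs ^ 2) ^ 2 := by ring
        _ ≤ (R ^ 2) ^ 2 := Nat.pow_le_pow_left (Nat.pow_le_pow_left habs 2) 2
        _ ≤ (Nat.sqrt N) ^ 2 := Nat.pow_le_pow_left (Nat.sqrt_le' _) 2
        _ ≤ N := Nat.sqrt_le' N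
    have : ((c.natAbs ^ 4 : ℕ) : ℤ) ≤ N := by exact_mod_cast h4
    rwa [Nat.cast_pow, natAbs_pow_four_cast] at this
  -- the index set of pairs `(c, c')`, `c' ≠ ±c`, and the fibres
  let I : Finset (ℤ × ℤ) := {cc ∈ Bc ×ˢ Bc | ¬(cc.2 = cc.1 ∨ cc.2 = -cc.1)}
  let E : ℤ × ℤ → Finset ((ℤ × ℤ) × (ℤ × ℤ)) := fun cc =>
    ({aa ∈ fiBox N | aa.1 ^ 2 - aa.2 ^ 2 = cc.2 ^ 4 - cc.1 ^ 4}).image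
      fun aa => ((aa.1, cc.1), (aa.2, cc.2))
  have hOsub : {q ∈ fiBox N ×ˢ fiBox N | q.1.1 ^ 2 + q.1.2 ^ 4 = q.2.1 ^ 2 + q.2.2 ^ 4 ∧
        ¬(q.2.2 = q.1.2 ∨ q.2.2 = -q.1.2) ∧ 1 ≤ q.1.1 ^ 2 + q.1.2 ^ 4 ∧
        q.1.1 ^ 2 + q.1.2 ^ 4 ≤ (N : ℤ)} ⊆ I.biUnion E := by
    rintro ⟨⟨a, c⟩, ⟨a', c'⟩⟩ hq
    simp only [mem_filter, mem_product, fiBox] at hq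
    obtain ⟨⟨⟨ha, -⟩, ⟨ha', -⟩⟩, hEq, hP, h1, hN⟩ := hq
    rw [mem_biUnion]
    refine ⟨(c, c'), ?_, ?_⟩
    · rw [mem_filter, mem_product]
      exact ⟨⟨hbox c (by nlinarith [sq_nonneg a]), hbox c' (by nlinarith [sq_nonneg a'])⟩, hP⟩
    · rw [mem_image]
      refine ⟨(a, a'), ?_, rfl⟩
      rw [mem_filter, fiBox, mem_product]
      exact ⟨⟨ha, ha'⟩, by show a ^ 2 - a' ^ 2 = c' ^ 4 - c ^ 4; linarith⟩
  have hE : ∀ cc ∈ I, (#(E cc) : ℝ) ≤ 2 * C * (2 * N : ℝ) ^ (1 / 4 : ℝ) := by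
    intro cc hcc
    rw [mem_filter, mem_product] at hcc
    obtain ⟨⟨hc, hc'⟩, hne⟩ := hcc
    set m : ℤ := cc.2 ^ 4 - cc.1 ^ 4 with hm
    have hm0 : m ≠ 0 := by
      intro h0
      exact hne (eq_or_eq_neg_of_pow_four_eq (by linarith [h0]))
    have hcard : #(E cc) ≤ 2 * m.natAbs.divisors.card := by
      refine card_image_le.trans ?_
      have := card_filter_sq_sub_sq_eq_le (Icc (-(N : ℤ)) N) hm0
      rwa [← fiBox] at this
    have hmabs : (m.natAbs : ℝ) ≤ 2 * N := by
      have h1 := hc4 _ hc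
      have h2 := hc4 _ hc'
      have h3 : 0 ≤ cc.1 ^ 4 := by positivity
      have h4 : 0 ≤ cc.2 ^ 4 := by positivity
      have : (m.natAbs : ℤ) ≤ 2 * N := by
        rw [Int.natCast_natAbs, abs_le]; constructor <;> linarith
      exact_mod_cast this
    have hτ := hC m.natAbs (Int.natAbs_ne_zero.mpr hm0)
    calc (#(E cc) : ℝ) ≤ 2 * (m.natAbs.divisors.card : ℝ) := by exact_mod_cast hcard
      _ ≤ 2 * (C * (m.natAbs : ℝ) ^ (1 / 4 : ℝ)) := by gcongr
      _ ≤ 2 * (C * (2 * N : ℝ) ^ (1 / 4 : ℝ)) := by gcongr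
      _ = 2 * C * (2 * N : ℝ) ^ (1 / 4 : ℝ) := by ring
  have hIcard : (#I : ℝ) ≤ (2 * R + 1) ^ 2 := by
    have h1 : #I ≤ #(Bc ×ˢ Bc) := card_filter_le _ _
    have h2 : #(Bc ×ˢ Bc) = (2 * R + 1) ^ 2 := by
      rw [card_product, hBc, Int.card_Icc]
      have : (R : ℤ) + 1 - -(R : ℤ) = ((2 * R + 1 : ℕ) : ℤ) := by push_cast; ring
      rw [this, Int.toNat_natCast]; ring
    have : ((#I : ℕ) : ℝ) ≤ (((2 * R + 1) ^ 2 : ℕ) : ℝ) := by exact_mod_cast h2 ▸ h1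
    push_cast at this
    exact this
  have hnonneg : 0 ≤ 2 * C * (2 * N : ℝ) ^ (1 / 4 : ℝ) := by positivity
  calc (#{q ∈ fiBox N ×ˢ fiBox N | q.1.1 ^ 2 + q.1.2 ^ 4 = q.2.1 ^ 2 + q.2.2 ^ 4 ∧
        ¬(q.2.2 = q.1.2 ∨ q.2.2 = -q.1.2) ∧ 1 ≤ q.1.1 ^ 2 + q.1.2 ^ 4 ∧
        q.1.1 ^ 2 + q.1.2 ^ 4 ≤ (N : ℤ)} : ℝ)
      ≤ #(I.biUnion E) := by exact_mod_cast card_le_card hOsub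
    _ ≤ ∑ cc ∈ I, (#(E cc) : ℝ) := by exact_mod_cast card_biUnion_le
    _ ≤ ∑ cc ∈ I, 2 * C * (2 * N : ℝ) ^ (1 / 4 : ℝ) := sum_le_sum hE
    _ = #I * (2 * C * (2 * N : ℝ) ^ (1 / 4 : ℝ)) := by rw [sum_const, nsmul_eq_mul]
    _ ≤ (2 * R + 1) ^ 2 * (2 * C * (2 * N : ℝ) ^ (1 / 4 : ℝ)) := by gcongr
    _ = _ := by ring

/-- Fibrewise: `a_n² ≤ 4 a_n + #(off-diagonal quadruples over n)` for `1 ≤ n ≤ N`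
(`card_solutions_sq_diag_le`, `card_solutions_sq_offdiag_le`). [folklore] -/
theorem sq_fiRepCount_le_add_card_fiber {N n : ℕ} (hn : n ∈ Icc 1 N) :
    fiRepCount n ^ 2 ≤ 4 * fiRepCount n +
      #{q ∈ {q ∈ fiBox N ×ˢ fiBox N | q.1.1 ^ 2 + q.1.2 ^ 4 = q.2.1 ^ 2 + q.2.2 ^ 4 ∧
        ¬(q.2.2 = q.1.2 ∨ q.2.2 = -q.1.2) ∧ 1 ≤ q.1.1 ^ 2 + q.1.2 ^ 4 ∧
        q.1.1 ^ 2 + q.1.2 ^ 4 ≤ (N : ℤ)} | (q.1.1 ^ 2 + q.1.2 ^ 4).toNat = n} := by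
  have hsq : fiRepCount n ^ 2 =
      #({ac ∈ fiBox n | ac.1 ^ 2 + ac.2 ^ 4 = (n : ℤ)} ×ˢ {ac ∈ fiBox n | ac.1 ^ 2 + ac.2 ^ 4 = (n : ℤ)}) := by
    rw [card_product, sq, fiRepCount]
  have hsplit := Finset.card_filter_add_card_filter_not
    (s := {ac ∈ fiBox n | ac.1 ^ 2 + ac.2 ^ 4 = (n : ℤ)} ×ˢ {ac ∈ fiBox n | ac.1 ^ 2 + ac.2 ^ 4 = (n : ℤ)})
    (fun q => (q.2.2 = q.1.2 ∨ q.2.2 = -q.1.2))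
  rw [hsq, ← hsplit]
  exact add_le_add (card_solutions_sq_diag_le n) (card_solutions_sq_offdiag_le hn)

/-- Summing the fibres: the off-diagonal quadruples over all `n ∈ [1, N]`. [folklore] -/
theorem sum_card_fiber_eq_card (N : ℕ) :
    ∑ n ∈ Icc 1 N, #{q ∈ {q ∈ fiBox N ×ˢ fiBox N | q.1.1 ^ 2 + q.1.2 ^ 4 = q.2.1 ^ 2 + q.2.2 ^ 4 ∧
        ¬(q.2.2 = q.1.2 ∨ q.2.2 = -q.1.2) ∧ 1 ≤ q.1.1 ^ 2 + q.1.2 ^ 4 ∧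
        q.1.1 ^ 2 + q.1.2 ^ 4 ≤ (N : ℤ)} | (q.1.1 ^ 2 + q.1.2 ^ 4).toNat = n} =
      #{q ∈ fiBox N ×ˢ fiBox N | q.1.1 ^ 2 + q.1.2 ^ 4 = q.2.1 ^ 2 + q.2.2 ^ 4 ∧
        ¬(q.2.2 = q.1.2 ∨ q.2.2 = -q.1.2) ∧ 1 ≤ q.1.1 ^ 2 + q.1.2 ^ 4 ∧
        q.1.1 ^ 2 + q.1.2 ^ 4 ≤ (N : ℤ)} := by
  symm
  refine card_eq_sum_card_fiberwise fun q hq => ?_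
  have hq' := (mem_filter.mp (mem_coe.mp hq)).2
  obtain ⟨-, -, h1, h2⟩ := hq'
  rw [mem_coe, mem_Icc]
  omega

/-- **`∑_{n ≤ N} a_n² ≤ 4 ∑_{n ≤ N} a_n + 2C (2N)^{1/4} (2⌊N^{1/4}⌋ + 1)²`** whenever
`τ(m) ≤ C m^{1/4}` for all `m ≥ 1` (`sq_fiRepCount_le_add_card_fiber` summed over `n`,
`sum_card_fiber_eq_card`, `card_offdiag_quadruples_le`). [cite: FriedlanderIwaniecAnnals1998, §2 (2.2) and §3, closing paragraph] -/
theorem sum_sq_fiRepCount_le (N : ℕ) {C : ℝ}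
    (hC : ∀ m : ℕ, m ≠ 0 → (#m.divisors : ℝ) ≤ C * (m : ℝ) ^ (1 / 4 : ℝ)) :
    ∑ n ∈ Icc 1 N, (fiRepCount n : ℝ) ^ 2 ≤
      4 * ∑ n ∈ Icc 1 N, (fiRepCount n : ℝ) +
        2 * C * (2 * N : ℝ) ^ (1 / 4 : ℝ) * (2 * Nat.sqrt (Nat.sqrt N) + 1) ^ 2 := by
  have hnat : ∑ n ∈ Icc 1 N, fiRepCount n ^ 2 ≤
      4 * ∑ n ∈ Icc 1 N, fiRepCount n + #{q ∈ fiBox N ×ˢ fiBox N | q.1.1 ^ 2 + q.1.2 ^ 4 = q.2.1 ^ 2 + q.2.2 ^ 4 ∧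
        ¬(q.2.2 = q.1.2 ∨ q.2.2 = -q.1.2) ∧ 1 ≤ q.1.1 ^ 2 + q.1.2 ^ 4 ∧
        q.1.1 ^ 2 + q.1.2 ^ 4 ≤ (N : ℤ)} := by
    calc ∑ n ∈ Icc 1 N, fiRepCount n ^ 2
        ≤ ∑ n ∈ Icc 1 N, (4 * fiRepCount n +
            #{q ∈ {q ∈ fiBox N ×ˢ fiBox N | q.1.1 ^ 2 + q.1.2 ^ 4 = q.2.1 ^ 2 + q.2.2 ^ 4 ∧
        ¬(q.2.2 = q.1.2 ∨ q.2.2 = -q.1.2) ∧ 1 ≤ q.1.1 ^ 2 + q.1.2 ^ 4 ∧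
        q.1.1 ^ 2 + q.1.2 ^ 4 ≤ (N : ℤ)} | (q.1.1 ^ 2 + q.1.2 ^ 4).toNat = n}) :=
          by
            apply Finset.sum_le_sum
            intro n hn
            exact sq_fiRepCount_le_add_card_fiber hn
      _ = 4 * ∑ n ∈ Icc 1 N, fiRepCount n + #{q ∈ fiBox N ×ˢ fiBox N | q.1.1 ^ 2 + q.1.2 ^ 4 = q.2.1 ^ 2 + q.2.2 ^ 4 ∧
        ¬(q.2.2 = q.1.2 ∨ q.2.2 = -q.1.2) ∧ 1 ≤ q.1.1 ^ 2 + q.1.2 ^ 4 ∧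
        q.1.1 ^ 2 + q.1.2 ^ 4 ≤ (N : ℤ)} := by
          rw [sum_add_distrib, mul_sum, sum_card_fiber_eq_card]
  have hreal : ((∑ n ∈ Icc 1 N, fiRepCount n ^ 2 : ℕ) : ℝ) ≤
      ((4 * ∑ n ∈ Icc 1 N, fiRepCount n + #{q ∈ fiBox N ×ˢ fiBox N | q.1.1 ^ 2 + q.1.2 ^ 4 = q.2.1 ^ 2 + q.2.2 ^ 4 ∧
        ¬(q.2.2 = q.1.2 ∨ q.2.2 = -q.1.2) ∧ 1 ≤ q.1.1 ^ 2 + q.1.2 ^ 4 ∧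
        q.1.1 ^ 2 + q.1.2 ^ 4 ≤ (N : ℤ)} : ℕ) : ℝ) := by
    exact_mod_cast hnat
  push_cast at hreal
  have hO := card_offdiag_quadruples_le N hC
  linarith

/-- **Discharge of the named fact `FriedlanderIwaniec1998_hyp22`** ((2.2) for the sequence (4.1)):
`x^{1/3} (∑_{n ≤ x} a_n²)^{1/2} ≤ A(x)` for all large `x`, since
`∑_{n ≤ x} a_n² ≪ x^{3/4}` (`sum_sq_fiRepCount_le` with the divisor bound `τ(n) ≪ n^{1/4}`,
`Literature.NumberTheory.Sieve.exists_card_divisors_le_mul_rpow`) while `2κ x^{3/4} ≤ A(x) ≤ 6κ x^{3/4}`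
(`FriedlanderIwaniecPrimes.fiCount_bounds`).
[cite: FriedlanderIwaniecAnnals1998, §2 (2.2) and §3, closing paragraph] -/
theorem FriedlanderIwaniec1998_hyp22_holds : FriedlanderIwaniec1998_hyp22 := by
  obtain ⟨C, hC1, hC⟩ := exists_card_divisors_le_mul_rpow (by norm_num : (0 : ℝ) < 1 / 4)
  have hκ := friedlanderIwaniecKappa_pos
  set C' : ℝ := 4 * (6 * friedlanderIwaniecKappa) + 54 * C with hC'def
  have hC'0 : 0 < C' := by positivity
  refine ⟨1, one_pos, ?_⟩
  have hev : ∀ᶠ x : ℝ in atTop, Real.sqrt C' / (2 * friedlanderIwaniecKappa) ≤ x ^ (1 / 24 : ℝ) :=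
    (tendsto_rpow_atTop (by norm_num : (0 : ℝ) < 1 / 24)).eventually_ge_atTop _
  filter_upwards [hev, FriedlanderIwaniecPrimes.fiCount_bounds FriedlanderIwaniec1998_count_asymp_holds,
    eventually_ge_atTop 4] with x hx24 hbounds hx4
  obtain ⟨hlow, hA⟩ := hbounds
  have hx0 : (0 : ℝ) < x := by linarith
  have hx1 : (1 : ℝ) ≤ x := by linarith
  set N : ℕ := ⌊x⌋₊ with hN
  have hNx : (N : ℝ) ≤ x := Nat.floor_le hx0.le
  -- `∑ a_n = A(x)`
  have hsumA : ∑ n ∈ Icc 1 N, (fiRepCount n : ℝ) = fiCount x := by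
    rw [fiCount, ← hN]
  have hS2 := sum_sq_fiRepCount_le N hC
  rw [hsumA] at hS2
  -- bounds for the pieces
  have hR : (Nat.sqrt (Nat.sqrt N) : ℝ) ≤ x ^ (1 / 4 : ℝ) := by
    have h4 : ((Nat.sqrt (Nat.sqrt N) : ℕ) : ℝ) ^ 4 ≤ x := by
      have : (Nat.sqrt (Nat.sqrt N)) ^ 4 ≤ N := by
        calc (Nat.sqrt (Nat.sqrt N)) ^ 4 = ((Nat.sqrt (Nat.sqrt N)) ^ 2) ^ 2 := by ring
          _ ≤ (Nat.sqrt N) ^ 2 := Nat.pow_le_pow_left (Nat.sqrt_le' _) 2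
          _ ≤ N := Nat.sqrt_le' _
      calc ((Nat.sqrt (Nat.sqrt N) : ℕ) : ℝ) ^ 4 ≤ N := by exact_mod_cast this
        _ ≤ x := hNx
    calc (Nat.sqrt (Nat.sqrt N) : ℝ) = (((Nat.sqrt (Nat.sqrt N) : ℝ)) ^ 4) ^ (4⁻¹ : ℝ) :=
        (Real.pow_rpow_inv_natCast (by positivity) (by norm_num)).symm
      _ ≤ x ^ (4⁻¹ : ℝ) := Real.rpow_le_rpow (by positivity) h4 (by norm_num)
      _ = x ^ (1 / 4 : ℝ) := by norm_num
  have h2N : (2 * N : ℝ) ^ (1 / 4 : ℝ) ≤ 2 * x ^ (1 / 4 : ℝ) := by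
    calc (2 * N : ℝ) ^ (1 / 4 : ℝ) ≤ (16 * x) ^ (1 / 4 : ℝ) :=
          Real.rpow_le_rpow (by positivity) (by linarith) (by norm_num)
      _ = (16 : ℝ) ^ (1 / 4 : ℝ) * x ^ (1 / 4 : ℝ) := Real.mul_rpow (by norm_num) hx0.le
      _ = 2 * x ^ (1 / 4 : ℝ) := by
          rw [show (16 : ℝ) = 2 ^ (4 : ℕ) by norm_num, ← Real.rpow_natCast,
            ← Real.rpow_mul (by norm_num)]
          norm_num
  have hsq : (2 * (Nat.sqrt (Nat.sqrt N) : ℝ) + 1) ^ 2 ≤ 9 * x ^ (1 / 2 : ℝ) := by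
    have h14 : 1 ≤ x ^ (1 / 4 : ℝ) := Real.one_le_rpow hx1 (by norm_num)
    have hhalf : x ^ (1 / 2 : ℝ) = x ^ (1 / 4 : ℝ) * x ^ (1 / 4 : ℝ) := by
      rw [← Real.rpow_add hx0]; norm_num
    rw [hhalf]
    nlinarith
  have h34 : x ^ (3 / 4 : ℝ) = x ^ (1 / 4 : ℝ) * x ^ (1 / 2 : ℝ) := by
    rw [← Real.rpow_add hx0]; norm_num
  have hC0 : 0 ≤ C := by linarith
  -- `∑ a_n² ≤ C' x^{3/4}`
  have hS2' : ∑ n ∈ Icc 1 N, (fiRepCount n : ℝ) ^ 2 ≤ C' * x ^ (3 / 4 : ℝ) := by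
    have hoff : 2 * C * (2 * N : ℝ) ^ (1 / 4 : ℝ) * (2 * (Nat.sqrt (Nat.sqrt N) : ℝ) + 1) ^ 2 ≤
        54 * C * x ^ (3 / 4 : ℝ) := by
      calc 2 * C * (2 * N : ℝ) ^ (1 / 4 : ℝ) * (2 * (Nat.sqrt (Nat.sqrt N) : ℝ) + 1) ^ 2
          ≤ 2 * C * (2 * x ^ (1 / 4 : ℝ)) * (9 * x ^ (1 / 2 : ℝ)) := by gcongr
        _ = 36 * C * x ^ (3 / 4 : ℝ) := by rw [h34]; ring
        _ ≤ 54 * C * x ^ (3 / 4 : ℝ) := by nlinarith [Real.rpow_nonneg hx0.le (3 / 4 : ℝ)]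
    rw [hC'def]
    nlinarith [Real.rpow_nonneg hx0.le (3 / 4 : ℝ), hS2]
  -- conclude: `x^{1/3} √Σ ≤ √C' x^{1/3 + 3/8} ≤ 2κ x^{3/4} ≤ A(x)`
  rw [one_mul]
  have hsqrtS : Real.sqrt (∑ n ∈ Icc 1 N, (fiRepCount n : ℝ) ^ 2) ≤
      Real.sqrt C' * x ^ (3 / 8 : ℝ) := by
    calc Real.sqrt (∑ n ∈ Icc 1 N, (fiRepCount n : ℝ) ^ 2) ≤ Real.sqrt (C' * x ^ (3 / 4 : ℝ)) :=
          Real.sqrt_le_sqrt hS2'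
      _ = Real.sqrt C' * Real.sqrt (x ^ (3 / 4 : ℝ)) := Real.sqrt_mul hC'0.le _
      _ = Real.sqrt C' * x ^ (3 / 8 : ℝ) := by
          rw [Real.sqrt_eq_rpow (x ^ (3 / 4 : ℝ)), ← Real.rpow_mul hx0.le]; norm_num
  have hx24' : Real.sqrt C' ≤ 2 * friedlanderIwaniecKappa * x ^ (1 / 24 : ℝ) := by
    have := (div_le_iff₀ (by positivity)).mp hx24
    linarith
  have hsplit : x ^ (3 / 4 : ℝ) = x ^ (1 / 24 : ℝ) * (x ^ (1 / 3 : ℝ) * x ^ (3 / 8 : ℝ)) := by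
    rw [← Real.rpow_add hx0, ← Real.rpow_add hx0]; norm_num
  calc x ^ (1 / 3 : ℝ) * Real.sqrt (∑ n ∈ Icc 1 ⌊x⌋₊, (fiRepCount n : ℝ) ^ 2)
      ≤ x ^ (1 / 3 : ℝ) * (Real.sqrt C' * x ^ (3 / 8 : ℝ)) := by rw [← hN]; gcongr
    _ = Real.sqrt C' * (x ^ (1 / 3 : ℝ) * x ^ (3 / 8 : ℝ)) := by ring
    _ ≤ (2 * friedlanderIwaniecKappa * x ^ (1 / 24 : ℝ)) * (x ^ (1 / 3 : ℝ) * x ^ (3 / 8 : ℝ)) := by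
        gcongr
    _ = 2 * friedlanderIwaniecKappa * x ^ (3 / 4 : ℝ) := by rw [hsplit]; ring
    _ ≤ fiCount x := hlow

end Hyp22

/-! ### parity.S17 (qualitative clause) down the printed DAG -/

section Corollaries

/-- **Infinitely many primes `a² + b⁴` from (4.7)–(4.8)**: with (4.2) discharged
(`FriedlanderIwaniec1998_count_asymp_holds`), the qualitative clause of parity.S17 follows from
the prime asymptotic `FriedlanderIwaniec1998_primeSum_asymp` alone, via
`friedlanderIwaniecSum_isEquivalent_of_primeSum` and
`setOf_prime_sq_add_pow_four_infinite_of_isEquivalent`.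
[cite: FriedlanderIwaniecAnnals1998, §1 Theorem 1 and §4 (4.7)–(4.8)] -/
theorem setOf_prime_sq_add_pow_four_infinite_of_primeSum
    (h47 : FriedlanderIwaniec1998_primeSum_asymp) : setOf_prime_sq_add_pow_four_infinite :=
  setOf_prime_sq_add_pow_four_infinite_of_isEquivalent
    (friedlanderIwaniecSum_isEquivalent_of_primeSum h47)

/-- **(4.7) with (4.8) from six named facts**: as `FriedlanderIwaniec1998_primeSum_asymp_of_inputs`,
with the hypothesis (2.2) now discharged (`FriedlanderIwaniec1998_hyp22_holds`).
[cite: FriedlanderIwaniecAnnals1998, §4, deduction of (4.7) from Propositions 2.1, 3.5, 4.1] -/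
theorem FriedlanderIwaniec1998_primeSum_asymp_of_inputs' (h21 : FriedlanderIwaniec1998_prop21)
    (h35 : FriedlanderIwaniec1998_prop35) (h41 : FriedlanderIwaniec1998_prop41)
    (h48 : FriedlanderIwaniec1998_densityConstant) (h27 : FriedlanderIwaniec1998_hyp27)
    (h28 : FriedlanderIwaniec1998_hyp28) : FriedlanderIwaniec1998_primeSum_asymp :=
  FriedlanderIwaniec1998_primeSum_asymp_of_inputs h21 h35 h41 h48 FriedlanderIwaniec1998_hyp22_holds
    h27 h28

/-- **Theorem 1 (parity.S17, `∼` form) from six named facts** (Prop. 2.1, Prop. 3.5, Prop. 4.1,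
(4.8), (2.7), (2.8)), (2.2) being discharged. [cite: FriedlanderIwaniecAnnals1998, Theorem 1 via §4] -/
theorem friedlanderIwaniecSum_isEquivalent_of_inputs' (h21 : FriedlanderIwaniec1998_prop21)
    (h35 : FriedlanderIwaniec1998_prop35) (h41 : FriedlanderIwaniec1998_prop41)
    (h48 : FriedlanderIwaniec1998_densityConstant) (h27 : FriedlanderIwaniec1998_hyp27)
    (h28 : FriedlanderIwaniec1998_hyp28) : friedlanderIwaniecSum_isEquivalent :=
  friedlanderIwaniecSum_isEquivalent_of_primeSum
    (FriedlanderIwaniec1998_primeSum_asymp_of_inputs' h21 h35 h41 h48 h27 h28)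

/-- **Infinitely many primes `a² + b⁴` (parity.S17, qualitative clause) from the printed
architecture**: from the six named facts `FriedlanderIwaniec1998_prop21`, `_prop35`, `_prop41`,
`_densityConstant`, `_hyp27`, `_hyp28` of `FriedlanderIwaniecPrimes`; everything else on the
printed route (the lattice-point count (4.2), hypotheses (2.1), (2.2), (2.4)–(2.6), the ranges,
the deduction of (1.1), the prime powers, `κ > 0`) is proved. The discharge
`setOf_prime_sq_add_pow_four_infinite_holds` is this theorem applied to the (future) discharges
of those six facts. [cite: FriedlanderIwaniecAnnals1998, §1 Theorem 1] -/
theorem setOf_prime_sq_add_pow_four_infinite_of_inputs (h21 : FriedlanderIwaniec1998_prop21)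
    (h35 : FriedlanderIwaniec1998_prop35) (h41 : FriedlanderIwaniec1998_prop41)
    (h48 : FriedlanderIwaniec1998_densityConstant) (h27 : FriedlanderIwaniec1998_hyp27)
    (h28 : FriedlanderIwaniec1998_hyp28) : setOf_prime_sq_add_pow_four_infinite :=
  setOf_prime_sq_add_pow_four_infinite_of_isEquivalent
    (friedlanderIwaniecSum_isEquivalent_of_inputs' h21 h35 h41 h48 h27 h28)

end Corollaries

end Literature.NumberTheory.Sieve

end
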